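import Literature.MathematicalPhysics.QuantumFieldTheory.Balaban1983to89.B9Thm315WholeBlocksRect
import Literature.MathematicalPhysics.QuantumFieldTheory.Balaban1983to89.B9Eq3169Comb
import Literature.MathematicalPhysics.QuantumFieldTheory.Balaban1983to89.B9Eq310Hermitian

/-!
# `Balaban1983to89.Node00.OpsYSectELetters` — T. Bałaban, *Propagators for lattice gauge theories in a background field*, Commun. Math. Phys. **99**
# (1985) 389–434 [Balaban1985BackgroundPropagators], Sect. E pp. 427–432, (3.168)–(3.169) p. 430 and (3.185) p. 432: THE SECT. E LETTERS OF RECORD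
# `μ` (3.169) AND `D̄ = D_V` (3.168) OF NODE 00's OPERATOR LAYER AS GENUINE FUNCTIONS OF THE BACKGROUND — the axial frame of (3.169) on the unit
# torus `T₁^{(k)}` at a member (blocks = `L`-blocks on `Λ′`, contours = the combs of [5] p. 24, transports `R(V)`), the `ℂ`-linear maps
# `B ↦ μ(B)` and `μ ↦ D̄μ` on NODE 00's carriers, the record `sectELettersYOfRecord x 𝔳 𝔢₀` (the Sect. E letter record with its `mu ∕ Dbar`
# fields THESE genuine letters), the identity `(1 + D̄μ)B = E(B)` with the tree's `AxialFrame.dress`, THE LOCALITY FACES OF THE LEFT OUTER FACTOR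
# `P_Λ(1 + D̄μ)P_Λ` of (3.185) (finite support of the kernels of `μ`, `D̄`, `1 + D̄μ` in the block currency of `B9Thm315WholeSectERep.LocalOuterY`,
# the row-mass bounds `Σ_q ‖(1 + D̄μ)_{pq}‖ ≤ 1 + 4(d+1)ℓ` for norm-one structure groups), and THE METRIC CURRENCY of
# `B9Thm315WholeBlocksRect.localOuterY_of_letters` (ranges `r_D = 1`, `r_μ = ℓ + 1` along the `k`-block placing `πSY`, masses `m_D = 2`,
# `m_μ = 2(d+1)ℓ`), whence ★★ `localOuterY_ofRecord : LocalOuterY x (sectELettersYOfRecord x 𝔳 𝔢₀) (max 0 (max (ℓ+2) (r_{μ*}+r_{D*}))) (1 + 4(d+1)ℓ)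
# (1 + m_{μ*}m_{D*}) U` given only the four right-letter (`μ*`, `D̄*`) facts of the parameter

statement-level construction with citation tags; proofs where landed; nothing here is a claim about the Yang–Mills mass gap, the continuum limit or OS.

WHAT IS BUILT (all `def`s are genuine functions of the background `U`; every theorem is proved, no `sorry`, standard axioms):
* §1 (generic, over the tree's abstract `B9Eq3169Mu.AxialFrame A` with contracting transports `‖R_b v‖ ≤ ‖v‖`, `‖R_b⁻¹ v‖ ≤ ‖v‖`): the KERNEL
  BOUNDS of `μ` and `E = 1 + D̄μ(·)` on bond deltas `δ_q ⊗ a` by OCCURRENCE COUNTS of `q` in the contours — `norm_mu_sgl_le`, `norm_dress_sgl_le`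
  (`‖E(δ_q a)(p)‖ ≤ c_{pq}‖a‖`), `sum_dressWtY_le` (`Σ_q c_{pq} ≤ 1 + 4ℓ₀` when contours have length `≤ ℓ₀`), and the SUPPORT `dress_sgl_eq_zero`
  (`E(δ_q a)(p) = 0` unless `q = p` or `q` is axial in the block of an end of `p`; from the tree's `dress_congr`);
* §2 (generic): `ℂ`-linearity of `trSum ∕ hol ∕ bavg ∕ mu ∕ cod ∕ dress` for transports commuting with complex scalars; the `ℂ`-linear maps `muCLin`
  (`B ↦ μ(B)`), `codCLin` (`μ ↦ D̄μ`) and `dress_eq_add_cod_mu` (`E(B) = B + D̄(μ(B))`);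
* §3 THE AXIAL FRAME AT A MEMBER `axialFrameY x : AxialFrame (USiteY x) (IBondY x.toKIdx)`: sites = the unit torus `T₁^{(k)} = Site (PV …) x.k`
  (period `L·M_h·P′_μ`, `sitesPerDir_k`, so `L`-blocks tile it), integer chart `labK ∕ ofZ`, `b₋ ∕ b₊` of an index bond = the `k`-fold block
  points of its ends (`usrc ∕ utgt`, via `B15DeterminingSets.embIter` and `B5Eq118OneStroke.iterBlockOf`; `iterBlockOf_embIter`), `Λ′` as the
  predicate `GoodY` (the whole `L`-block consists of block points of sites of `Λ`), representatives = block corners on `Λ′` (`ublk`), contours = the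
  combs `B9Eq3169Comb.comb (ℓ+1)` transported to index bonds (`uΓ`; chain property `isChainFrom_pmap_comb` from `comb_chain`), uniform weights (`uw`);
  contour length `≤ (d+1)ℓ` (`length_uΓ_le`);
* §4 TRANSPORTS: `adEquivY V : 𝔸 ≃ₗ[ℂ] 𝔸` (`X ↦ VXV⁻¹`, [5] (56)), the AVERAGED-FIELD PARAMETER `𝔳 : AvY 𝔸 x` (`V` on unit bonds as a function of
  `U`; inhabitant of record `avYOfRecord` = NODE 00's taxicab transporter `parBY` between the block centres — DECLARED DICTIONARY for `V = U_k`, exact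
  at `U = 1` (`avYOfRecord_one`) and `G`-valued (`avYOfRecord_mem`)), the bond transports `RVY x 𝔳 U q` and their contraction under a norm-one group
  (`norm_RVY_le ∕ norm_RVY_symm_le` from `hG1 : ∀ g ∈ G, ‖g‖ ≤ 1`);
* §5 THE LETTERS: the placing `repY : USiteY x → SiteY x.toKIdx` (unit site ↦ its centre fine site, injective), `readK ∕ placeK` (restriction ∕
  extension by zero, `readK_placeK`), ★ `muY x 𝔳 U : (IBondY → 𝔸) →ₗ[ℂ] (SiteY → 𝔸)` = (3.169), ★ `DbarY x 𝔳 U : (SiteY → 𝔸) →ₗ[ℂ] (IBondY → 𝔸)`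
  = (3.168), ★ `one_add_DbarY_muY` (`(1 + D̄μ)B = E(B) = (axialFrameY x).dress (RVY x 𝔳 U) B`), ★★ the record `sectELettersYOfRecord x 𝔳 𝔢₀`
  (`mu := muY`, `Dbar := DbarY`; the transposes `muT ∕ DbarT`, `Λ̃`, `C ∕ C*`, `⟨D̃⁽²⁾,J⟩`, `G̃₂` stay the parameter's — located gap (O2″)) and the
  family `sectEYOfRecord`;
* §6 RECORD LEVEL: `AvEY ∕ avEYOfRecord` (the parameter over a Stage 3′(Y) family) and `sectEYOfRecord` (the family of letter records);
* §7 FACES: support and kernel bounds of `μ` (`muY_apply_of_not_range`, `muY_deltaY_repY_eq_zero`, `norm_muY_deltaY_le`, `sum_muWtY_le ≤ 2(d+1)ℓ`),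
  of `D̄` (`DbarY_deltaY_eq_zero`, `norm_DbarY_deltaY_le`, `sum_DbarWtY_le ≤ 2`), and of the LEFT OUTER FACTOR `outerLY x 𝔢 U = P_Λ(1 + D̄μ)P_Λ` of
  `B9Thm315WholeSectERep` at the record: `blockCLM_outerLY_eq_zero` (support: `q = p` or `q` axial in the block of `b₋` or `b₊` of `p`) and
  ★ `rowMass_outerLY_le : Σ_q ‖(outerLY)_{pq}‖ ≤ 1 + 4(d+1)ℓ` (norm-one `G`, `G`-valued `𝔳 U`);
* §8 METRIC CURRENCY (the hypotheses `hDr hDm hμr hμm` of n06-m's `B9Thm315WholeBlocksRect.localOuterY_of_letters`, in p21's `tdistK` over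
  `B9PinGeometryKLevelV1.kLab`): the coordinate criterion `tdistK_le_of_coords` (labels congruent within `n` mod the period ⇒ `|y − y′| ≤ n`), the
  chart lemmas `tdistK_labK_ofZ_le ∕ tdistK_labK_shift_le ∕ tdistK_labK_le_of_mem_block` (one step `≤ 1`, one `L`-block `≤ ℓ`), `kLab_eq_labK_or`
  (the `k`-label of an index bond is the label of `b₋` or of `b₊`), `utgt_eq_or_shift` (`b₊ ∈ {b₋, b₋ + e_μ}`, iterating `B10StarCount.blockOf_shift`),
  the placing `πSY` (`πSY_repY = labK`), `exists_block_of_inAx`, the block faces `rowMass₂_DbarY_le ≤ 2`, `rowMass₂_muY_le ≤ 2(d+1)ℓ`,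
  `range₂_DbarY_le ≤ 1`, `range₂_muY_le ≤ ℓ + 1`, and ★★ `localOuterY_ofRecord`.

HONEST MARGINS. (i) `V = U_k` of print is the `k`-fold AVERAGE of `U` ([5]); the inhabitant of record transports `U` itself along NODE 00's taxicab
contour between block centres (declared dictionary; it is `G`-valued, `= 1` at `U = 1`, and enters print's bounds only through `|V| = 1`); every
statement below is over the PARAMETER `𝔳`, so the genuine average can be substituted without touching this file. (ii) `μ*`, `D̄*` are NOT constructed
(no `*`-structure on the abstract fibre `𝔸` is assumed): the right outer factor's locality stays displayed (n06-m's `LocalOuterY.rangeR ∕ colMassR`).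
(iii) The metric faces are stated along the `k`-BLOCK placing `πSY` (fine site ↦ label of its `k`-block), the placing n06-m's `localOuterY_of_letters`
quantifies over; the resulting `LocalOuterY` range `max 0 (max (ℓ+2) (r_{μ*}+r_{D*}))` is in `unitDistY = tdistK ∘ kLab` units (`L^k`-blocks of
`T_η`), cruder than print's `O(1)·ξ` but of the displayed shape; the right-letter inputs (`r_{μ*}, m_{μ*}, r_{D*}, m_{D*}`) stay hypotheses by (ii). (iv) `Λ′` is read as «`L`-blocks all of whose unit sites are block points of `Λ`»; print's
`Λ′` is any union of such blocks inside `Λ^{(k)}` minus a margin — immaterial for (3.185), recorded. (v) CONVENTION WORD for the lineage's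
adjoint letters (N06 located point №4 = n06-i g7's LOCATED-ROW26-UNITS; asked by dag-lead DEDUP-259 and ref-E READ-4; a READING, no declaration
changes): every adjoint of this lineage is FLAT — `OpsYDeltaA.QsY` is the transported lift of r03's `QsE := LinearMap.adjoint QE` on
`EuclideanSpace ℝ (BondIdx D)` (unweighted sums on both sides), i.e. the transported TRANSPOSE `Qᵀ`; print's `Q*` ((3.13); [4] (2.18)) is the
adjoint for `⟨A,A′⟩ = η^{D}Σ_b` and `⟨B,B′⟩_𝔅 = Σ_j Σ_{c ∈ Λ_j} (L^jη)^{D}` (cf. (3.16)), so `Q*_print = QsY ∘ diag(L^{jD})` on `Λ_j` (`D = d+1`,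
`L = ℓ+1`; the identity on `Λ₀`). Exact operator-level dictionary: `OpsYSectDE.QGQOfY parB G = (QGQ*)_print ∘ diag(L^{−jD})`;
`QGQinvOfY ∕ QGQinvY ∕ QG1QinvY = diag(L^{jD}) ∘ (QGQ*)⁻¹_print` — a ROW factor, so the convention DOES reach `QG1QinvY` inside `OpsYSectE.deltaKY`
(3.156); `HOfY ∕ HDY ∕ H1Y ∕ frakPY ∕ GGY` = print's (the two factors cancel); `QsY ∘ aY ∘ QY` = print's `Q*aQ` of (3.16) and `aY` = print's `a`
in the same flat-form convention BECAUSE r06's band `B6CubeWindowV1.GlobalBand` puts the measure factor into the weights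
(`i.w ∈ [b₀,b₁]·L^{jD}·(c_f/L^j)²`); hence the three terms of `deltaKY = QG1Qinv − a − D2J` sit in ONE convention — `deltaKY = diag(L^{jD}) ∘ Δ_k`
of print, i.e. `η^{−D}×` the flat matrix of the quadratic form (3.156) (`⟨B,(QG₁Q*)⁻¹B⟩_𝔅 = η^{D}·Bᵀ(QG1QinvY U)B`, `a⟨B,B⟩_𝔅 = η^{D}·Bᵀ(aY)B`) —
provided the parameter `𝔢.D2J` is supplied flat-form as well. KERNEL READINGS: `OpsYOfLetters.siteKernelOfOp … id id` returns flat matrix entries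
`S(δ_{c′}E)(c)`; under print's kernel convention `(SF)(c) = Σ_{c′}(L^{j′}η)^{D}S(c,c′)F(c′)` (n06-i g7's reading) a flat entry of a print operator is
`(L^{j′}η)^{D}·ker_print(c,c′)`, so for the `(QGQ*)⁻¹`-type letters `ker_print = η^{D}(L^jη)^{−D}(L^{j′}η)^{−D}·flat` — n06-i's weight `ω` EXACTLY —
while for covariance-type letters (inverses of flat-form letters, e.g. `OpsYSectE.CkY` (3.157) given flat-form `elimC ∕ elimCt ∕ D2J`) the level
factors cancel and `flat = η^{D}·ker_print` (a global constant `≤ 1`: the printed upper bound (3.187) transfers to row 24's flat `Ck` verbatim).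
(3.157)–(3.158) and [4] (2.154)–(2.158) are pairing-covariant identities, valid flat with flat adjoints. Nothing of [B9] Sect. E's inequalities
((3.170)–(3.184)) is claimed. Net new unproved facts: 0.
-/

noncomputable section

namespace Literature.MathematicalPhysics.QuantumFieldTheory.Balaban1983to89.Node00

open B6KLevelCensusIndexV1 (KIdx)
open B9PinMembersKLevelV1 (MemberY)
open B9PinGeometryKLevelV1 (inΛY unitDistY)
open B6GlobalChartV1 (PV toBox boxEquiv domT iterBlockOf_mem_domT_iff)
open B6MultiLevelBoxOperator (N0)
open B5Eq118OneStroke (iterBlockOf iterBlockOf_succ)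
open B15DeterminingSets (embIter)
open B6Elimination (corner mem_block corner_apply corner_le lt_corner_add mem_block_corner corner_corner
  corner_eq_of_mem_block mem_block_corner_iff)
open B6BondElimination (unitVec unitVec_apply add_unitVec_apply)
open B9Eq3169Comb (comb comb_chain corner_of_mem_comb comb_of_eq_corner length_comb_le)
open B9Eq39Adjoint (R R_inv_R R_R_inv R_one)
open B9Eq310Hermitian (norm_R_le)
open B9Thm315WholeBlocks (blockCLM blockCLM_apply)
open B9Thm315WholeSectERep (outerLY LocalOuterY)
open B9Thm315WholeBlocksRect (blockCLM₂ blockCLM₂_apply localOuterY_of_letters)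
open B4Reflection242 (blk)
open B9Thm314GpFlatTorusGeometry (tdistK cenLab)
open B9Thm314GpFlatOmegaOff (tdistK_self)
open B9Thm314QGGQInvFlatTransfer (tdistK_triangle tdistK_comm)
open B6Geom246MultiLevelTorus (toT norm_coe_le_abs_sub_mul)
open B9PinGeometryKLevelV1 (kLab)
open B6Ineq2142KLevelV1 (lvl baseSite base iterBlockOf_baseSite lvl_le lvl_le_mK iterBlockOf_eq_of_le)
open B6GlobalChartV1 (blk_toBox)
open B10StarCount (blockOf_shift)
open B9Eq3169Mu
open scoped Matrix

variable {d ℓ : ℕ} {hd : 1 ≤ d + 1} {hL : Odd (ℓ + 1) ∧ 1 < ℓ + 1} {b₀ b₁ : ℝ} {Mstar : ℕ}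

/-! ## §1 Block-level locality of `E = 1 + D̄μ(·)` over an abstract (3.169) frame with contracting transports -/

section BlockLocality

variable {X Bond 𝔤 : Type} [Fintype X] [DecidableEq X] [DecidableEq Bond]
variable [NormedAddCommGroup 𝔤] [NormedSpace ℝ 𝔤]

/-- the number of occurrences of the bond `q` in a contour (real-valued). [cite: Balaban1985BackgroundPropagators, (3.169) p.430, bookkeeping] -/
def occY (q : Bond) : List Bond → ℝ
  | [] => 0
  | b :: Γ => (if b = q then 1 else 0) + occY q Γ

omit [NormedAddCommGroup 𝔤] [NormedSpace ℝ 𝔤] [Fintype X] [DecidableEq X] in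
/-- occurrence numbers are nonnegative. [cite: Balaban1985BackgroundPropagators, (3.169) p.430, bookkeeping] -/
theorem occY_nonneg (q : Bond) : ∀ Γ : List Bond, 0 ≤ occY q Γ
  | [] => le_rfl
  | b :: Γ => by
      rw [occY]
      have := occY_nonneg q Γ
      split_ifs <;> linarith

omit [NormedAddCommGroup 𝔤] [NormedSpace ℝ 𝔤] [Fintype X] [DecidableEq X] in
/-- summed over all bonds, the occurrence numbers of a contour give its length. [cite: Balaban1985BackgroundPropagators, (3.169) p.430, bookkeeping] -/
theorem sum_occY [Fintype Bond] : ∀ Γ : List Bond, ∑ q, occY q Γ = (Γ.length : ℝ)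
  | [] => by simp [occY]
  | b :: Γ => by
      simp only [occY, List.length_cons, Nat.cast_add, Nat.cast_one]
      rw [Finset.sum_add_distrib, sum_occY Γ, Finset.sum_ite_eq, if_pos (Finset.mem_univ _)]
      ring

/-- the bond function `δ_q ⊗ a` (value `a` at `q`, `0` elsewhere). [cite: Balaban1985BackgroundPropagators, (3.187) p.432 (kernel entries), dictionary] -/
def sglY (q : Bond) (a : 𝔤) : Bond → 𝔤 := fun b => if b = q then a else 0

omit [Fintype X] [DecidableEq X] [NormedSpace ℝ 𝔤] in
/-- `δ_q ⊗ a` evaluated. [cite: Balaban1985BackgroundPropagators, (3.187) p.432, bookkeeping] -/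
@[simp] theorem sglY_apply (q : Bond) (a : 𝔤) (b : Bond) : sglY q a b = if b = q then a else 0 := rfl

variable (R : Bond → 𝔤 ≃ₗ[ℝ] 𝔤)

omit [Fintype X] [DecidableEq X] in
/-- **transported sums of `δ_q ⊗ a` along a contour** are bounded by (occurrences of `q`)·‖a‖ when the transports contract.
[cite: Balaban1985BackgroundPropagators, (3.169) p.430] -/
theorem norm_trSum_sgl_le (hR : ∀ b v, ‖R b v‖ ≤ ‖v‖) (q : Bond) (a : 𝔤) :
    ∀ Γ : List Bond, ‖trSum R (sglY q a) Γ‖ ≤ occY q Γ * ‖a‖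
  | [] => by simp [occY]
  | b :: Γ => by
      rw [trSum_cons, occY, add_mul]
      refine (norm_add_le _ _).trans (add_le_add ?_ ((hR b _).trans (norm_trSum_sgl_le hR q a Γ)))
      by_cases h : b = q
      · simp [h]
      · simp [h]

omit [Fintype X] [DecidableEq X] [DecidableEq Bond] in
/-- the inverse transport along a contour contracts when each inverse bond transport does. [cite: Balaban1985BackgroundPropagators, (3.169) p.430, bookkeeping] -/
theorem norm_hol_symm_le (hR' : ∀ b v, ‖(R b).symm v‖ ≤ ‖v‖) : ∀ (Γ : List Bond) (v : 𝔤), ‖(hol R Γ).symm v‖ ≤ ‖v‖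
  | [], v => by simp
  | b :: Γ, v => by
      show ‖((hol R Γ).trans (R b)).symm v‖ ≤ ‖v‖
      rw [LinearEquiv.symm_trans_apply]
      exact (norm_hol_symm_le hR' Γ _).trans (hR' b v)

variable (A : AxialFrame X Bond)

/-- **the axial occurrence weight** `N_y(q) = Σ_{y′ ∈ B(y)} w(y′)·#(q ∈ Γ_{y′}) + #(q ∈ Γ_y)`: the coefficient of `‖a‖` in the bound of `μ(δ_q ⊗ a)(y)`.
[cite: Balaban1985BackgroundPropagators, (3.169) p.430] -/
def axOccY (y : X) (q : Bond) : ℝ := (∑ y' ∈ A.block y, A.w y' * occY q (A.Γ y')) + occY q (A.Γ y)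

/-- **the block weight of `E = 1 + D̄μ(·)`** at `(p, q)`: `1_{p = q} + N_{p₊}(q) + N_{p₋}(q)`. [cite: Balaban1985BackgroundPropagators, (3.169) p.430, (3.185) p.432] -/
def dressWtY (p q : Bond) : ℝ := (if p = q then 1 else 0) + axOccY A (A.tgt p) q + axOccY A (A.src p) q

omit [DecidableEq Bond] [NormedSpace ℝ 𝔤] in
/-- the block mean of transported sums of `δ_q ⊗ a` is bounded by its occurrence weight. [cite: Balaban1985BackgroundPropagators, (3.169) p.430] -/
theorem norm_bavg_sgl_le [DecidableEq Bond] [NormedSpace ℝ 𝔤] (R : Bond → 𝔤 ≃ₗ[ℝ] 𝔤) (hR : ∀ b v, ‖R b v‖ ≤ ‖v‖) (q : Bond) (a : 𝔤) (y : X) :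
    ‖A.bavg R (sglY q a) y‖ ≤ (∑ y' ∈ A.block y, A.w y' * occY q (A.Γ y')) * ‖a‖ := by
  unfold AxialFrame.bavg
  rw [Finset.sum_mul]
  refine (norm_sum_le _ _).trans (Finset.sum_le_sum fun y' _ => ?_)
  rw [norm_smul, Real.norm_of_nonneg (A.w_nonneg y'), mul_assoc]
  exact mul_le_mul_of_nonneg_left (norm_trSum_sgl_le R hR q a _) (A.w_nonneg y')

/-- **`‖μ(δ_q ⊗ a)(y)‖ ≤ N_y(q)·‖a‖`** for contracting transports. [cite: Balaban1985BackgroundPropagators, (3.169) p.430] -/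
theorem norm_mu_sgl_le (hR : ∀ b v, ‖R b v‖ ≤ ‖v‖) (hR' : ∀ b v, ‖(R b).symm v‖ ≤ ‖v‖) (q : Bond) (a : 𝔤) (y : X) :
    ‖A.mu R (sglY q a) y‖ ≤ axOccY A y q * ‖a‖ := by
  unfold AxialFrame.mu
  refine (norm_hol_symm_le R hR' _ _).trans ((norm_sub_le _ _).trans ?_)
  rw [axOccY, add_mul]
  exact add_le_add (norm_bavg_sgl_le A R hR q a y) (norm_trSum_sgl_le R hR q a _)

/-- **`‖E(δ_q ⊗ a)(p)‖ ≤ W(p, q)·‖a‖`**: the `(p, q)` block of `E = 1 + D̄μ(·)` has operator norm at most the block weight.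
[cite: Balaban1985BackgroundPropagators, (3.169) p.430, (3.185) p.432] -/
theorem norm_dress_sgl_le (hR : ∀ b v, ‖R b v‖ ≤ ‖v‖) (hR' : ∀ b v, ‖(R b).symm v‖ ≤ ‖v‖) (p q : Bond) (a : 𝔤) :
    ‖A.dress R (sglY q a) p‖ ≤ dressWtY A p q * ‖a‖ := by
  have e : A.dress R (sglY q a) p = sglY q a p + (R p (A.mu R (sglY q a) (A.tgt p)) - A.mu R (sglY q a) (A.src p)) := rfl
  rw [e, dressWtY, add_mul, add_mul, add_assoc]
  refine (norm_add_le _ _).trans (add_le_add ?_ ((norm_sub_le _ _).trans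
    (add_le_add ((hR p _).trans (norm_mu_sgl_le R A hR hR' q a _)) (norm_mu_sgl_le R A hR hR' q a _))))
  by_cases h : p = q
  · simp [h]
  · simp [h]

omit [NormedAddCommGroup 𝔤] [NormedSpace ℝ 𝔤] in
/-- the `μ`-weights are nonnegative. [cite: Balaban1985BackgroundPropagators, (3.169) p.430, bookkeeping] -/
theorem axOccY_nonneg (y : X) (q : Bond) : 0 ≤ axOccY A y q :=
  add_nonneg (Finset.sum_nonneg fun y' _ => mul_nonneg (A.w_nonneg y') (occY_nonneg q _)) (occY_nonneg q _)

omit [NormedAddCommGroup 𝔤] [NormedSpace ℝ 𝔤] in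
/-- the `E`-weights are nonnegative. [cite: Balaban1985BackgroundPropagators, (3.169) p.430, bookkeeping] -/
theorem dressWtY_nonneg (p q : Bond) : 0 ≤ dressWtY A p q := by
  unfold dressWtY
  have h1 := axOccY_nonneg A (A.tgt p) q
  have h2 := axOccY_nonneg A (A.src p) q
  have h0 : (0 : ℝ) ≤ (if p = q then 1 else 0) := by split <;> norm_num
  linarith

omit [DecidableEq Bond] [NormedAddCommGroup 𝔤] [NormedSpace ℝ 𝔤] in
/-- **row sums of the axial occurrence weights**: `Σ_q N_y(q) ≤ 2ℓ₀` when every contour has length `≤ ℓ₀` (`Σ w = 1` on the block).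
[cite: Balaban1985BackgroundPropagators, (3.169) p.430] -/
theorem sum_axOccY_le [DecidableEq Bond] [Fintype Bond] {ℓ₀ : ℝ} (hℓ : ∀ y, ((A.Γ y).length : ℝ) ≤ ℓ₀) (y : X) :
    ∑ q, axOccY A y q ≤ 2 * ℓ₀ := by
  simp only [axOccY]
  rw [Finset.sum_add_distrib, sum_occY, Finset.sum_comm]
  have h1 : ∑ y' ∈ A.block y, ∑ q, A.w y' * occY q (A.Γ y') = ∑ y' ∈ A.block y, A.w y' * ((A.Γ y').length : ℝ) := by
    refine Finset.sum_congr rfl fun y' _ => ?_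
    rw [← Finset.mul_sum, sum_occY]
  rw [h1]
  have h2 : ∑ y' ∈ A.block y, A.w y' * ((A.Γ y').length : ℝ) ≤ ∑ y' ∈ A.block y, A.w y' * ℓ₀ :=
    Finset.sum_le_sum fun y' _ => mul_le_mul_of_nonneg_left (hℓ y') (A.w_nonneg y')
  rw [← Finset.sum_mul, A.sum_w, one_mul] at h2
  linarith [hℓ y]

omit [DecidableEq Bond] [NormedAddCommGroup 𝔤] [NormedSpace ℝ 𝔤] in
/-- **ROW MASS OF `E`**: `Σ_q W(p, q) ≤ 1 + 4ℓ₀` — print's *"bounded uniformly"* constant, depending on `d` and `L` only through the contour length.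
[cite: Balaban1985BackgroundPropagators, (3.169) p.430, (3.185)–(3.187) p.432] -/
theorem sum_dressWtY_le [DecidableEq Bond] [Fintype Bond] {ℓ₀ : ℝ} (hℓ : ∀ y, ((A.Γ y).length : ℝ) ≤ ℓ₀) (p : Bond) :
    ∑ q, dressWtY A p q ≤ 1 + 4 * ℓ₀ := by
  simp only [dressWtY]
  rw [Finset.sum_add_distrib, Finset.sum_add_distrib, Finset.sum_ite_eq, if_pos (Finset.mem_univ _)]
  have h1 := sum_axOccY_le A hℓ (A.tgt p)
  have h2 := sum_axOccY_le A hℓ (A.src p)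
  linarith

/-- **FINITE RANGE OF `E` (support form)**: the `(p, q)` block of `E = 1 + D̄μ(·)` vanishes unless `q = p` or `q` is an axial bond of the block of
`p₋` or of `p₊` (`dress_congr`). [cite: Balaban1985BackgroundPropagators, (3.169) p.430, (3.185) p.432] -/
theorem dress_sgl_eq_zero {p q : Bond} (hpq : q ≠ p) (hs : ¬ A.InAx (A.src p) q) (ht : ¬ A.InAx (A.tgt p) q) (a : 𝔤) :
    A.dress R (sglY q a) p = 0 := by
  have h0 : A.dress R (0 : Bond → 𝔤) = 0 := map_zero (A.dressLin R)
  have h := A.dress_congr R (B₁ := sglY q a) (B₂ := 0) (b := p)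
    (by rw [sglY_apply, Pi.zero_apply, if_neg (fun h : p = q => hpq h.symm)])
    (fun b' hb' => by
      have hb : b' ≠ q := fun e => hs (e ▸ hb')
      simp [hb])
    (fun b' hb' => by
      have hb : b' ≠ q := fun e => ht (e ▸ hb')
      simp [hb])
  rw [h, h0, Pi.zero_apply]

end BlockLocality

/-! ## §2 `ℂ`-linearity of `μ`, `D̄`, `E` for transports commuting with complex scalars -/

section CLinear

variable {X Bond 𝔤 : Type} [AddCommGroup 𝔤] [Module ℂ 𝔤]
variable (R : Bond → 𝔤 ≃ₗ[ℝ] 𝔤) (hC : ∀ (b : Bond) (c : ℂ) (v : 𝔤), R b (c • v) = c • R b v)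
include hC

/-- transported sums are `ℂ`-homogeneous when the bond transports commute with complex scalars (`R(V)` does: `V(cX)V⁻¹ = cVXV⁻¹`).
[cite: Balaban1985BackgroundPropagators, (3.169) p.430 («a linear function of B»), bookkeeping] -/
theorem trSum_smulC (c : ℂ) (B : Bond → 𝔤) : ∀ Γ : List Bond, trSum R (c • B) Γ = c • trSum R B Γ
  | [] => by simp
  | b :: Γ => by rw [trSum_cons, trSum_cons, trSum_smulC c B Γ, Pi.smul_apply, hC, smul_add]

/-- the transport along a contour is `ℂ`-homogeneous. [cite: Balaban1985BackgroundPropagators, (3.169) p.430, bookkeeping] -/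
theorem hol_smulC (c : ℂ) : ∀ (Γ : List Bond) (v : 𝔤), hol R Γ (c • v) = c • hol R Γ v
  | [], v => rfl
  | b :: Γ, v => by rw [hol_cons_apply, hol_cons_apply, hol_smulC c Γ v, hC]

/-- the inverse transport along a contour is `ℂ`-homogeneous. [cite: Balaban1985BackgroundPropagators, (3.169) p.430, bookkeeping] -/
theorem hol_symm_smulC (c : ℂ) (Γ : List Bond) (v : 𝔤) : (hol R Γ).symm (c • v) = c • (hol R Γ).symm v := by
  apply (hol R Γ).injective
  rw [LinearEquiv.apply_symm_apply, hol_smulC R hC, LinearEquiv.apply_symm_apply]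

/-- the covariant difference `D̄` is `ℂ`-homogeneous. [cite: Balaban1985BackgroundPropagators, (3.168) p.430, bookkeeping] -/
theorem cod_smulC (src tgt : Bond → X) (c : ℂ) (μ : X → 𝔤) : cod R src tgt (c • μ) = c • cod R src tgt μ := by
  funext b
  simp only [cod_apply, Pi.smul_apply, hC, smul_sub]

/-- **`D̄ = D_V` of (3.168) as a `ℂ`-linear map** `μ ↦ D̄μ` (site functions → bond functions). [cite: Balaban1985BackgroundPropagators, (3.168) p.430, p.390] -/
def codCLin (src tgt : Bond → X) : (X → 𝔤) →ₗ[ℂ] (Bond → 𝔤) where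
  toFun := cod R src tgt
  map_add' μ₁ μ₂ := cod_add R src tgt μ₁ μ₂
  map_smul' c μ := cod_smulC R hC src tgt c μ

/-- `codCLin` evaluated. [cite: Balaban1985BackgroundPropagators, (3.168) p.430, bookkeeping] -/
@[simp] theorem codCLin_apply (src tgt : Bond → X) (μ : X → 𝔤) : codCLin R hC src tgt μ = cod R src tgt μ := rfl

variable [Fintype X] [DecidableEq X] (A : AxialFrame X Bond)

/-- the block means are `ℂ`-homogeneous. [cite: Balaban1985BackgroundPropagators, (3.169) p.430, bookkeeping] -/
theorem bavg_smulC (c : ℂ) (B : Bond → 𝔤) (y : X) : A.bavg R (c • B) y = c • A.bavg R B y := by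
  unfold AxialFrame.bavg
  rw [Finset.smul_sum]
  refine Finset.sum_congr rfl fun y' _ => ?_
  rw [trSum_smulC R hC, smul_comm]

/-- **`μ` IS `ℂ`-LINEAR** (print: *"a linear function of B"*; additivity is `AxialFrame.mu_add`). [cite: Balaban1985BackgroundPropagators, (3.169) p.430] -/
theorem mu_smulC (c : ℂ) (B : Bond → 𝔤) (y : X) : A.mu R (c • B) y = c • A.mu R B y := by
  unfold AxialFrame.mu
  rw [bavg_smulC R hC A, trSum_smulC R hC, ← smul_sub, hol_symm_smulC R hC]

/-- `E = 1 + D̄μ(·)` is `ℂ`-homogeneous. [cite: Balaban1985BackgroundPropagators, (3.169) p.430, bookkeeping] -/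
theorem dress_smulC (c : ℂ) (B : Bond → 𝔤) : A.dress R (c • B) = c • A.dress R B := by
  have hmu : A.mu R (c • B) = c • A.mu R B := funext fun y => mu_smulC R hC A c B y
  unfold AxialFrame.dress
  rw [hmu, cod_smulC R hC, smul_add]

/-- **`μ` of (3.169) as a `ℂ`-linear map** `B ↦ μ(B)` (bond functions → site functions). [cite: Balaban1985BackgroundPropagators, (3.169) p.430] -/
def muCLin : (Bond → 𝔤) →ₗ[ℂ] (X → 𝔤) where
  toFun := A.mu R
  map_add' B₁ B₂ := funext fun y => A.mu_add R B₁ B₂ y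
  map_smul' c B := funext fun y => mu_smulC R hC A c B y

/-- `muCLin` evaluated. [cite: Balaban1985BackgroundPropagators, (3.169) p.430, bookkeeping] -/
@[simp] theorem muCLin_apply (B : Bond → 𝔤) : muCLin R hC A B = A.mu R B := rfl

/-- **`E = 1 + D̄μ(·)`**: `B + D̄(μ(B))` IS the frame's `dress`. [cite: Balaban1985BackgroundPropagators, (3.169) p.430, (3.185) p.432] -/
theorem dress_eq_add_cod_mu (B : Bond → 𝔤) : A.dress R B = B + codCLin R hC A.src A.tgt (muCLin R hC A B) := rfl

end CLinear

/-! ## §3 The unit lattice `T₁^{(k)}` at a member: chart, `L`-blocks, combs, the axial frame of (3.169) -/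

section UnitLattice

variable (x : MemberY d ℓ hd hL b₀ b₁ Mstar)

/-- the UNIT-LATTICE SITES `T₁^{(k)}` at a member (the `k`-fold block points of `T_η`, `η = L^{-k}`): the sites on which `μ` of (3.169) lives.
[cite: Balaban1985BackgroundPropagators, p.427 («unit lattice propagators»), (3.169) p.430, dictionary] -/
abbrev USiteY : Type := Site (PV d ℓ x.m x.K hd hL) x.k

/-- the positively oriented UNIT-LATTICE BONDS at a member. [cite: Balaban1985BackgroundPropagators, (3.168) p.430, dictionary] -/
abbrev UBondY : Type := PBond (PV d ℓ x.m x.K hd hL) x.k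

/-- `0 < L`. [cite: Balaban1985BackgroundPropagators, p.389, bookkeeping] -/
theorem ell_succ_pos : 0 < ℓ + 1 := Nat.succ_pos ℓ

/-- `1 ≤ k` at a member (`2 ≤ k`). [cite: Balaban1984PropagatorsII, (2.1) p.224, bookkeeping] -/
theorem one_le_k : 1 ≤ x.k := le_trans (by norm_num) x.hk2

/-- **THE UNIT TORUS IS TILED BY `L`-BLOCKS**: its period is `L·(M_h·P′_μ)` in every direction. [cite: Balaban1984PropagatorsII, (2.1) p.224, bookkeeping] -/
theorem sitesPerDir_k (μ : Fin (d + 1)) : (PV d ℓ x.m x.K hd hL).sitesPerDir x.k = (ℓ + 1) * (x.Mh * x.P' μ) := by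
  have h1 : (ℓ + 1) ^ x.k * ((ℓ + 1) * (x.Mh * x.P' μ)) = (PV d ℓ x.m x.K hd hL).sitesPerDir 0 := x.hN μ
  rw [B6AgreeQaQV1Chart.sitesPerDir_zero_eq_mul (PV d ℓ x.m x.K hd hL) x.hk] at h1
  exact (Nat.eq_of_mul_eq_mul_left (Nat.pow_pos (Nat.succ_pos ℓ)) h1).symm

/-- the integer LABEL CHART of the unit torus (`val` coordinates). [cite: Balaban1984PropagatorsII, (2.1) p.224, dictionary] -/
def labK (y : USiteY x) : Fin (d + 1) → ℤ := fun μ => ((y μ).val : ℤ)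

/-- the inverse chart (reduction mod the period). [cite: Balaban1984PropagatorsII, (2.1) p.224, dictionary] -/
def ofZ (z : Fin (d + 1) → ℤ) : USiteY x := fun μ => ((z μ : ℤ) : ZMod ((PV d ℓ x.m x.K hd hL).sitesPerDir x.k))

/-- `ofZ ∘ labK = id`. [cite: Balaban1984PropagatorsII, (2.1) p.224, bookkeeping] -/
@[simp] theorem ofZ_labK (y : USiteY x) : ofZ x (labK x y) = y := by
  funext μ
  simp [ofZ, labK]

/-- labels are nonnegative. [cite: Balaban1984PropagatorsII, (2.1) p.224, bookkeeping] -/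
theorem labK_nonneg (y : USiteY x) (μ : Fin (d + 1)) : 0 ≤ labK x y μ := Int.natCast_nonneg _

/-- labels are below the period. [cite: Balaban1984PropagatorsII, (2.1) p.224, bookkeeping] -/
theorem labK_lt (y : USiteY x) (μ : Fin (d + 1)) : labK x y μ < (PV d ℓ x.m x.K hd hL).sitesPerDir x.k := by
  unfold labK
  exact_mod_cast ZMod.val_lt (y μ)

/-- `labK ∘ ofZ = id` on the fundamental box. [cite: Balaban1984PropagatorsII, (2.1) p.224, bookkeeping] -/
theorem labK_ofZ {z : Fin (d + 1) → ℤ} (hz : ∀ μ, 0 ≤ z μ ∧ z μ < (PV d ℓ x.m x.K hd hL).sitesPerDir x.k) : labK x (ofZ x z) = z := by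
  funext μ
  simp only [labK, ofZ]
  rw [ZMod.val_intCast]
  exact Int.emod_eq_of_lt (hz μ).1 (hz μ).2

/-- one lattice step in the chart: `ofZ (z + e_μ) = (ofZ z) + e_μ`. [cite: Balaban1985BackgroundPropagators, (3.168) p.430, bookkeeping] -/
theorem ofZ_add_unitVec (z : Fin (d + 1) → ℤ) (μ : Fin (d + 1)) : ofZ x (z + unitVec μ) = (ofZ x z).shift μ := by
  funext ν
  simp only [ofZ, Site.shift, Function.update_apply, add_unitVec_apply]
  by_cases h : ν = μ
  · subst h; simp
  · simp [h]

/-- **an `L`-block of the unit torus lies in the fundamental box**: every label of `B(corner(labK y))` is in `[0, period)`.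
[cite: Balaban1984PropagatorsI, (1.6) p.18; Balaban1984PropagatorsII, (2.1) p.224, bookkeeping] -/
theorem inBox_of_mem_block {y : USiteY x} {z : Fin (d + 1) → ℤ} (hz : z ∈ B6Elimination.block (ℓ + 1) (corner (ℓ + 1) (labK x y))) (μ : Fin (d + 1)) :
    0 ≤ z μ ∧ z μ < (PV d ℓ x.m x.K hd hL).sitesPerDir x.k := by
  obtain ⟨h1, h2⟩ := (mem_block.1 hz) μ
  have hL0 : (0 : ℤ) < ((ℓ + 1 : ℕ) : ℤ) := by exact_mod_cast Nat.succ_pos ℓ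
  have hv0 := labK_nonneg x y μ
  have hc0 : 0 ≤ corner (ℓ + 1) (labK x y) μ := by
    rw [corner_apply]; exact mul_nonneg hL0.le (Int.ediv_nonneg hv0 hL0.le)
  refine ⟨hc0.trans h1, lt_of_lt_of_le h2 ?_⟩
  have hS : (((PV d ℓ x.m x.K hd hL).sitesPerDir x.k : ℕ) : ℤ) = ((ℓ + 1 : ℕ) : ℤ) * ((x.Mh * x.P' μ : ℕ) : ℤ) := by
    rw [sitesPerDir_k x μ]; push_cast; ring
  have hv : labK x y μ < ((x.Mh * x.P' μ : ℕ) : ℤ) * ((ℓ + 1 : ℕ) : ℤ) := by rw [mul_comm, ← hS]; exact labK_lt x y μ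
  have hq : labK x y μ / ((ℓ + 1 : ℕ) : ℤ) + 1 ≤ ((x.Mh * x.P' μ : ℕ) : ℤ) := Int.add_one_le_iff.2 (Int.ediv_lt_of_lt_mul hL0 hv)
  rw [corner_apply, hS]
  calc ((ℓ + 1 : ℕ) : ℤ) * (labK x y μ / ((ℓ + 1 : ℕ) : ℤ)) + ((ℓ + 1 : ℕ) : ℤ)
      = ((ℓ + 1 : ℕ) : ℤ) * (labK x y μ / ((ℓ + 1 : ℕ) : ℤ) + 1) := by ring
    _ ≤ ((ℓ + 1 : ℕ) : ℤ) * ((x.Mh * x.P' μ : ℕ) : ℤ) := mul_le_mul_of_nonneg_left hq hL0.le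

/-- **SAME `L`-BLOCK, SAME BLOCK POINT**: a label `z` in the `L`-block of `labK y` charts to a unit site with the block point of `y`.
[cite: Balaban1984PropagatorsI, (1.6) p.18, bookkeeping] -/
theorem blockOf_ofZ_eq {y : USiteY x} {z : Fin (d + 1) → ℤ} (hz : z ∈ B6Elimination.block (ℓ + 1) (corner (ℓ + 1) (labK x y))) :
    blockOf (ofZ x z) = blockOf y := by
  have hL0 : (0 : ℤ) < (ℓ : ℤ) + 1 := by positivity
  have hc := corner_eq_of_mem_block (ell_succ_pos) hz
  have hzl : labK x (ofZ x z) = z := labK_ofZ x (inBox_of_mem_block x hz)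
  funext μ
  show ((((ofZ x z μ).val / (ℓ + 1) : ℕ)) : ZMod ((PV d ℓ x.m x.K hd hL).sitesPerDir (x.k + 1))) =
    ((((y μ).val / (ℓ + 1) : ℕ)) : ZMod ((PV d ℓ x.m x.K hd hL).sitesPerDir (x.k + 1)))
  have e1 : (((ofZ x z μ).val : ℕ) : ℤ) = z μ := congr_fun hzl μ
  have e2 := congr_fun hc μ
  rw [corner_apply, corner_apply] at e2
  push_cast at e2
  have e3 : z μ / ((ℓ : ℤ) + 1) = labK x y μ / ((ℓ : ℤ) + 1) := mul_left_cancel₀ hL0.ne' e2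
  have e4 : ((((ofZ x z μ).val / (ℓ + 1) : ℕ)) : ℤ) = ((((y μ).val / (ℓ + 1) : ℕ)) : ℤ) := by
    push_cast; rw [e1, e3]; rfl
  rw [Int.natCast_inj.1 e4]

/-- **`Λ′` AS A PREDICATE ON UNIT SITES**: the whole `L`-block of `y` in `T₁^{(k)}` consists of `k`-fold block points of fine sites of `Λ` (print: *"Λ′ ⊂ T₁^{(k)},
or a sum of unit blocks if Λ′ is considered as a subset of T^{(k+1)}"*). [cite: Balaban1985BackgroundPropagators, p.427, dictionary] -/
def GoodY (y : USiteY x) : Prop := ∀ u : USiteY x, blockOf u = blockOf y → ∃ z ∈ x.Λ, iterBlockOf x.k z = u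

/-- `GoodY` is a property of the `L`-block. [cite: Balaban1985BackgroundPropagators, p.427, bookkeeping] -/
theorem goodY_iff_of_blockOf_eq {u y : USiteY x} (h : blockOf u = blockOf y) : GoodY x u ↔ GoodY x y := by
  unfold GoodY; rw [h]

/-- a good block lies in `Ω_k^{(k)}` of the member's domain sequence. [cite: Balaban1984PropagatorsII, (2.3) p.224; Balaban1985BackgroundPropagators, p.427, bookkeeping] -/
theorem mem_Om_of_good {y u : USiteY x} (hy : GoodY x y) (hu : blockOf u = blockOf y) : u ∈ (domT x.hN x.D x.hk).Om x.k := by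
  obtain ⟨z, hzΛ, hzu⟩ := hy u hu
  rw [← hzu]
  exact (iterBlockOf_mem_domT_iff x.hN x.D x.hk (one_le_k x) le_rfl z).2 (le_of_eq (x.hΛlev z hzΛ).symm)

/-- at the top level no unit site is deep (`Ω_{k+1} = ∅`). [cite: Balaban1984PropagatorsII, (2.3) p.224, bookkeeping] -/
theorem not_deep_k (u : USiteY x) : ¬ (domT x.hN x.D x.hk).Deep x.k u := by
  unfold B6SectADomainsV1.Domains.Deep
  rw [(domT x.hN x.D x.hk).Om_eq_empty (show (domT x.hN x.D x.hk).k < x.k + 1 from Nat.lt_succ_self _)]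
  exact Finset.notMem_empty _

/-- a unit bond sourced in `Ω_k^{(k)}` is a top-level index bond (`b ∈ Λ_k`). [cite: Balaban1984PropagatorsII, (2.3) p.224, bookkeeping] -/
theorem lamBond_of_src {b : UBondY x} (h : b.src ∈ (domT x.hN x.D x.hk).Om x.k) : (domT x.hN x.D x.hk).LamBond x.k b :=
  ⟨Or.inl h, not_deep_k x _, not_deep_k x _⟩

/-- THE INDEX BOND of a unit bond sourced in `Ω_k^{(k)}`. [cite: Balaban1984PropagatorsII, (2.3) p.224, dictionary] -/
def idxOfU (b : UBondY x) (h : b.src ∈ (domT x.hN x.D x.hk).Om x.k) : IBondY x.toKIdx := ⟨⟨Fin.last x.k, b⟩, lamBond_of_src x h⟩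

/-- `blockIterate ∘ embIter = id` (standing range). [cite: Balaban1987RG1, (0.3) p.252, bookkeeping] -/
theorem iterBlockOf_embIter {P : Params} : ∀ (j : ℕ), j ≤ P.m + P.K → ∀ y : Site P j, iterBlockOf j (embIter j y) = y
  | 0, _, y => rfl
  | j + 1, hj, y => by
    show blockOf (iterBlockOf j (embIter j (emb y))) = y
    rw [iterBlockOf_embIter j (by omega) (emb y), Site.blockOf_emb hj]

/-- **`b₋` ON THE UNIT LATTICE**: the `k`-fold block point of (the centre of) the source block of an index bond. [cite: Balaban1985BackgroundPropagators, (3.168) p.430, dictionary] -/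
def usrc (q : IBondY x.toKIdx) : USiteY x := iterBlockOf x.k (embIter (q.1.1 : ℕ) q.1.2.src)

/-- **`b₊` ON THE UNIT LATTICE**. [cite: Balaban1985BackgroundPropagators, (3.168) p.430, dictionary] -/
def utgt (q : IBondY x.toKIdx) : USiteY x := iterBlockOf x.k (embIter (q.1.1 : ℕ) q.1.2.tgt)

/-- `b₋` of a top-level index bond is its source. [cite: Balaban1985BackgroundPropagators, (3.168) p.430, bookkeeping] -/
@[simp] theorem usrc_idxOfU (b : UBondY x) (h : b.src ∈ (domT x.hN x.D x.hk).Om x.k) : usrc x (idxOfU x b h) = b.src :=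
  iterBlockOf_embIter x.k x.hk _

/-- `b₊` of a top-level index bond is its target. [cite: Balaban1985BackgroundPropagators, (3.168) p.430, bookkeeping] -/
@[simp] theorem utgt_idxOfU (b : UBondY x) (h : b.src ∈ (domT x.hN x.D x.hk).Om x.k) : utgt x (idxOfU x b h) = b.tgt :=
  iterBlockOf_embIter x.k x.hk _

/-- a comb label lies in the `L`-block of `labK y`. [cite: Balaban1985Averaging, p.24 (the contours Γ_{y,x}), bookkeeping] -/
theorem mem_block_of_mem_comb (y : USiteY x) {b : (Fin (d + 1) → ℤ) × Fin (d + 1)} (hb : b ∈ comb (ℓ + 1) (labK x y)) :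
    b.1 ∈ B6Elimination.block (ℓ + 1) (corner (ℓ + 1) (labK x y)) :=
  (mem_block_corner_iff ell_succ_pos).2 (corner_of_mem_comb ell_succ_pos _ b hb).1

/-- the unit source of a comb bond of a good block lies in `Ω_k^{(k)}`. [cite: Balaban1985BackgroundPropagators, p.427 + (3.169) p.430, bookkeeping] -/
theorem comb_src_mem_Om {y : USiteY x} (hy : GoodY x y) {b : (Fin (d + 1) → ℤ) × Fin (d + 1)} (hb : b ∈ comb (ℓ + 1) (labK x y)) :
    (⟨ofZ x b.1, b.2⟩ : UBondY x).src ∈ (domT x.hN x.D x.hk).Om x.k :=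
  mem_Om_of_good x hy (blockOf_ofZ_eq x (mem_block_of_mem_comb x y hb))

/-- the CORNER unit site of the `L`-block of `y` (its representative, [B5]'s convention). [cite: Balaban1985Averaging, (1.5) p.18 + p.24, dictionary] -/
def ucorner (y : USiteY x) : USiteY x := ofZ x (corner (ℓ + 1) (labK x y))

/-- the corner lies in the block. [cite: Balaban1985Averaging, p.24, bookkeeping] -/
theorem blockOf_ucorner (y : USiteY x) : blockOf (ucorner x y) = blockOf y :=
  blockOf_ofZ_eq x ((mem_block_corner_iff ell_succ_pos).2 (corner_corner ell_succ_pos _))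

/-- labels of the corner. [cite: Balaban1985Averaging, p.24, bookkeeping] -/
theorem labK_ucorner (y : USiteY x) : labK x (ucorner x y) = corner (ℓ + 1) (labK x y) :=
  labK_ofZ x (inBox_of_mem_block x ((mem_block_corner_iff ell_succ_pos).2 (corner_corner ell_succ_pos _)))

open Classical in
/-- **THE BLOCK REPRESENTATIVES `y ↦ ȳ`** of the frame: the corner of the `L`-block on `Λ′`, the site itself off `Λ′` (singleton blocks, where `μ = 0`).
[cite: Balaban1985BackgroundPropagators, (3.169) p.430 + p.427, dictionary] -/
def ublk (y : USiteY x) : USiteY x := if GoodY x y then ucorner x y else y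

open Classical in
/-- **THE CONTOURS `Γ_{ȳ,y}`** of (3.169) as lists of INDEX bonds: the comb of [5] p. 24 from the block corner to `y`, on `Λ′`; empty off `Λ′`.
[cite: Balaban1985BackgroundPropagators, (3.169) p.430; Balaban1985Averaging, p.24] -/
def uΓ (y : USiteY x) : List (IBondY x.toKIdx) :=
  if h : GoodY x y then
    (comb (ℓ + 1) (labK x y)).pmap (fun b hb => idxOfU x ⟨ofZ x b.1, b.2⟩ (comb_src_mem_Om x h hb)) (fun _ hb => hb)
  else []

open Classical in
/-- **THE BLOCK WEIGHTS** (uniform on each block: `L^{-(d+1)}` on `Λ′`, `1` off `Λ′`). [cite: Balaban1985BackgroundPropagators, (3.169) p.430, dictionary] -/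
def uw (y : USiteY x) : ℝ := (((Finset.univ.filter fun y' : USiteY x => ublk x y' = ublk x y).card : ℕ) : ℝ)⁻¹

/-- representatives, on `Λ′`. [cite: Balaban1985BackgroundPropagators, (3.169) p.430, bookkeeping] -/
theorem ublk_of_good {y : USiteY x} (h : GoodY x y) : ublk x y = ucorner x y := by
  classical
  exact if_pos h

/-- representatives, off `Λ′`. [cite: Balaban1985BackgroundPropagators, (3.169) p.430, bookkeeping] -/
theorem ublk_of_not_good {y : USiteY x} (h : ¬ GoodY x y) : ublk x y = y := by
  classical
  exact if_neg h

/-- contours, off `Λ′`. [cite: Balaban1985BackgroundPropagators, (3.169) p.430, bookkeeping] -/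
theorem uΓ_of_not_good {y : USiteY x} (h : ¬ GoodY x y) : uΓ x y = [] := by
  classical
  exact dif_neg h

/-- the corner of a good block is good. [cite: Balaban1985BackgroundPropagators, p.427, bookkeeping] -/
theorem goodY_ucorner {y : USiteY x} (h : GoodY x y) : GoodY x (ucorner x y) := (goodY_iff_of_blockOf_eq x (blockOf_ucorner x y)).2 h

/-- `pmap` of an empty list under a propositional equation (list plumbing for the comb transfer `uΓ`). [cite: Balaban1985Averaging, p.24, bookkeeping] -/
private theorem pmap_eq_nil_of_eq {α β : Type} {p : α → Prop} (f : ∀ a, p a → β) : ∀ {l : List α} (H : ∀ a ∈ l, p a), l = [] → l.pmap f H = []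
  | _, _, rfl => rfl

/-- **CHAIN TRANSFER**: the index-bond image of a chain of comb labels is a chain on the unit torus. [cite: Balaban1985Averaging, p.24, bookkeeping] -/
theorem isChainFrom_pmap_comb {y : USiteY x} (hy : GoodY x y) :
    ∀ (l : List ((Fin (d + 1) → ℤ) × Fin (d + 1))) (H : ∀ b ∈ l, b ∈ comb (ℓ + 1) (labK x y)) (z₀ z₁ : Fin (d + 1) → ℤ),
      IsChainFrom Prod.fst (fun b => b.1 + unitVec b.2) z₀ l z₁ →
      IsChainFrom (usrc x) (utgt x) (ofZ x z₀) (l.pmap (fun b hb => idxOfU x ⟨ofZ x b.1, b.2⟩ (comb_src_mem_Om x hy hb)) H) (ofZ x z₁)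
  | [], _, z₀, z₁, h => by
    rw [isChainFrom_nil] at h
    subst h
    exact (isChainFrom_nil _ _ _ _).2 rfl
  | b :: l, H, z₀, z₁, h => by
    rw [isChainFrom_cons] at h
    obtain ⟨h1, h2⟩ := h
    rw [List.pmap, isChainFrom_cons, usrc_idxOfU, utgt_idxOfU]
    refine ⟨by rw [← h1], ?_⟩
    have e : (⟨ofZ x b.1, b.2⟩ : UBondY x).tgt = ofZ x (b.1 + unitVec b.2) := (ofZ_add_unitVec x b.1 b.2).symm
    rw [e]
    exact isChainFrom_pmap_comb hy l _ _ _ h2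

/-- **THE AXIAL FRAME OF (3.169) AT A MEMBER** (instance of the tree's abstract `B9Eq3169Mu.AxialFrame` on the unit torus `T₁^{(k)}` with INDEX bonds):
`b₋, b₊` = unit block points of the bond's ends, blocks = `L`-blocks on `Λ′` (singletons off `Λ′`), contours = the combs of [5], uniform weights.
[cite: Balaban1985BackgroundPropagators, (3.169) p.430 + p.427; Balaban1985Averaging, p.24] -/
def axialFrameY : AxialFrame (USiteY x) (IBondY x.toKIdx) where
  src := usrc x
  tgt := utgt x
  blk := ublk x
  Γ := uΓ x
  w := uw x
  blk_blk y := by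
    by_cases hy : GoodY x y
    · rw [ublk_of_good x hy, ublk_of_good x (goodY_ucorner x hy)]
      show ofZ x (corner (ℓ + 1) (labK x (ucorner x y))) = ofZ x (corner (ℓ + 1) (labK x y))
      rw [labK_ucorner, corner_corner ell_succ_pos]
    · rw [ublk_of_not_good x hy, ublk_of_not_good x hy]
  chain y := by
    classical
    by_cases hy : GoodY x y
    · rw [ublk_of_good x hy]
      show IsChainFrom (usrc x) (utgt x) (ucorner x y) (dite (GoodY x y) _ _) y
      rw [dif_pos hy]
      have h := isChainFrom_pmap_comb x hy (comb (ℓ + 1) (labK x y)) (fun _ hb => hb) _ _ (comb_chain ell_succ_pos (labK x y))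
      rwa [ofZ_labK] at h
    · rw [ublk_of_not_good x hy, uΓ_of_not_good x hy, isChainFrom_nil]
  Γ_blk y := by
    classical
    by_cases hy : GoodY x y
    · rw [ublk_of_good x hy]
      show dite (GoodY x (ucorner x y)) _ _ = []
      rw [dif_pos (goodY_ucorner x hy)]
      exact pmap_eq_nil_of_eq _ _ (by rw [labK_ucorner]; exact comb_of_eq_corner ell_succ_pos (corner_corner ell_succ_pos _).symm)
    · rw [ublk_of_not_good x hy, uΓ_of_not_good x hy]
  w_nonneg y := inv_nonneg.2 (Nat.cast_nonneg _)
  w_sum y := by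
    classical
    have h1 : ∀ y' ∈ Finset.univ.filter (fun y' => ublk x y' = ublk x y), uw x y' = uw x y := by
      intro y' hy'
      have e : ublk x y' = ublk x y := (Finset.mem_filter.1 hy').2
      show (((Finset.univ.filter fun y'' : USiteY x => ublk x y'' = ublk x y').card : ℕ) : ℝ)⁻¹ = _
      simp only [uw, e]
    rw [Finset.sum_congr rfl h1, Finset.sum_const, nsmul_eq_mul]
    have h2 : (Finset.univ.filter (fun y' => ublk x y' = ublk x y)).card ≠ 0 :=
      Finset.card_ne_zero_of_mem (Finset.mem_filter.2 ⟨Finset.mem_univ _, rfl⟩)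
    have h3 : (((Finset.univ.filter (fun y' => ublk x y' = ublk x y)).card : ℕ) : ℝ) ≠ 0 := by exact_mod_cast h2
    exact mul_inv_cancel₀ h3

/-- the frame's contours have length `≤ (d+1)·ℓ` (a comb makes at most `L − 1` steps per direction). [cite: Balaban1985Averaging, p.24, bookkeeping] -/
theorem length_uΓ_le (y : USiteY x) : (((axialFrameY x).Γ y).length : ℝ) ≤ ((d + 1) * ℓ : ℕ) := by
  classical
  show ((uΓ x y).length : ℝ) ≤ _
  by_cases hy : GoodY x y
  · unfold uΓ
    rw [dif_pos hy, List.length_pmap]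
    exact_mod_cast (length_comb_le ell_succ_pos (labK x y)).trans (by simp)
  · rw [uΓ_of_not_good x hy, List.length_nil]; exact_mod_cast Nat.zero_le _

end UnitLattice


/-! ## §4 Transports `R(V)` over an averaged-field parameter -/

section Transport

variable {𝔸 : Type} [NormedRing 𝔸] [NormedAlgebra ℂ 𝔸] [CompleteSpace 𝔸]

/-- **`R(V) : X ↦ VXV⁻¹` as a `ℂ`-linear automorphism of the fibre** ([5] (56): *"R(X)Y = XYX⁻¹"*; NODE 00's `RL V` with inverse `R(V⁻¹)`).
[cite: Balaban1985Averaging, (56) p.28; Balaban1985BackgroundPropagators, (3.1) p.390] -/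
def adEquivY (V : 𝔸ˣ) : 𝔸 ≃ₗ[ℂ] 𝔸 :=
  { RL V with invFun := R V⁻¹, left_inv := R_inv_R V, right_inv := R_R_inv V }

omit [CompleteSpace 𝔸] in
/-- `adEquivY V X = VXV⁻¹`. [cite: Balaban1985Averaging, (56) p.28, bookkeeping] -/
@[simp] theorem adEquivY_apply (V : 𝔸ˣ) (X : 𝔸) : adEquivY V X = R V X := rfl

omit [CompleteSpace 𝔸] in
/-- `(adEquivY V)⁻¹ X = V⁻¹XV`. [cite: Balaban1985Averaging, (56) p.28, bookkeeping] -/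
@[simp] theorem adEquivY_symm_apply (V : 𝔸ˣ) (X : 𝔸) : (adEquivY V).symm X = R V⁻¹ X := rfl

variable (𝔸) (x : MemberY d ℓ hd hL b₀ b₁ Mstar)

/-- **THE AVERAGED-FIELD PARAMETER** `V` of (3.168)–(3.169): a configuration on the UNIT bonds of `T₁^{(k)}` as a function of the background `U`
(print: `V = U_k`, the `k`-fold average of [5]). [cite: Balaban1985BackgroundPropagators, (3.168) p.430; Balaban1985Averaging, (58) p.28, dictionary] -/
abbrev AvY : Type := CfgY 𝔸 x.toKIdx → UBondY x → 𝔸ˣ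

variable {𝔸}

/-- **THE INHABITANT OF RECORD of the averaged-field slot** (DECLARED DICTIONARY): `U` transported along NODE 00's taxicab contour between the CENTRES of
the two unit blocks (`parBY`), a `G`-valued unit-bond configuration equal to `1` at `U = 1`. [cite: Balaban1985BackgroundPropagators, (3.40) p.397 + (3.168) p.430, dictionary] -/
def avYOfRecord : AvY 𝔸 x := fun U b => parBY x.toKIdx U (embIter x.k b.src) (embIter x.k b.tgt)

/-- `U = 1` face: `V(1) = 1`. [cite: Balaban1985BackgroundPropagators, Cor. 3.5 p.407 (U = 1), bookkeeping] -/
@[simp] theorem avYOfRecord_one (b : UBondY x) : avYOfRecord x (fun _ _ => 1 : CfgY 𝔸 x.toKIdx) b = 1 := parBY_one _ _ _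

/-- the inhabitant of record is `G`-valued on `G`-valued backgrounds. [cite: Balaban1985BackgroundPropagators, (3.35) p.396, bookkeeping] -/
theorem avYOfRecord_mem {G : Subgroup 𝔸ˣ} {U : CfgY 𝔸 x.toKIdx} (hU : ∀ μ z, U μ z ∈ G) (b : UBondY x) : avYOfRecord x U b ∈ G :=
  parTaxiV_mem hU _ _

/-- the UNIT BOND under an index bond `q`: source `b₋ = usrc q`, direction that of `q`. [cite: Balaban1985BackgroundPropagators, (3.168) p.430, dictionary] -/
def ubondOfIdx (q : IBondY x.toKIdx) : UBondY x := ⟨usrc x q, q.1.2.dir⟩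

/-- **THE BOND TRANSPORTS `R(V(b))` of (3.168)–(3.169)** as real-linear automorphisms of the fibre (the tree's frame calculus is over `ℝ`).
[cite: Balaban1985BackgroundPropagators, (3.168)–(3.169) p.430] -/
def RVY (𝔳 : AvY 𝔸 x) (U : CfgY 𝔸 x.toKIdx) (q : IBondY x.toKIdx) : 𝔸 ≃ₗ[ℝ] 𝔸 := (adEquivY (𝔳 U (ubondOfIdx x q))).restrictScalars ℝ

/-- `RVY` evaluated. [cite: Balaban1985BackgroundPropagators, (3.168) p.430, bookkeeping] -/
@[simp] theorem RVY_apply (𝔳 : AvY 𝔸 x) (U : CfgY 𝔸 x.toKIdx) (q : IBondY x.toKIdx) (v : 𝔸) : RVY x 𝔳 U q v = R (𝔳 U (ubondOfIdx x q)) v := rfl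

/-- `RVY⁻¹` evaluated. [cite: Balaban1985BackgroundPropagators, (3.168) p.430, bookkeeping] -/
@[simp] theorem RVY_symm_apply (𝔳 : AvY 𝔸 x) (U : CfgY 𝔸 x.toKIdx) (q : IBondY x.toKIdx) (v : 𝔸) :
    (RVY x 𝔳 U q).symm v = R (𝔳 U (ubondOfIdx x q))⁻¹ v := rfl

/-- the bond transports commute with complex scalars. [cite: Balaban1985BackgroundPropagators, (3.169) p.430 («linear»), bookkeeping] -/
theorem RVY_smulC (𝔳 : AvY 𝔸 x) (U : CfgY 𝔸 x.toKIdx) : ∀ (q : IBondY x.toKIdx) (c : ℂ) (v : 𝔸), RVY x 𝔳 U q (c • v) = c • RVY x 𝔳 U q v :=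
  fun q c v => (adEquivY (𝔳 U (ubondOfIdx x q))).map_smul c v

/-- at `U = 1` the transports of record are the identity. [cite: Balaban1985BackgroundPropagators, Cor. 3.5 p.407 (U = 1), bookkeeping] -/
@[simp] theorem RVY_avYOfRecord_one (q : IBondY x.toKIdx) (v : 𝔸) : RVY x (avYOfRecord x) (fun _ _ => 1 : CfgY 𝔸 x.toKIdx) q v = v := by
  rw [RVY_apply, avYOfRecord_one, R_one]

/-- **CONTRACTION**: for a norm-one structure group (`‖g‖ ≤ 1` on `G`, e.g. `U(N)`) and `G`-valued `V`, `|R(V(b))v| ≤ |v|`. [cite: Balaban1985BackgroundPropagators, p.390, bookkeeping] -/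
theorem norm_RVY_le {G : Subgroup 𝔸ˣ} (hG1 : ∀ g ∈ G, ‖((g : 𝔸ˣ) : 𝔸)‖ ≤ 1) {𝔳 : AvY 𝔸 x} {U : CfgY 𝔸 x.toKIdx} (h𝔳 : ∀ b, 𝔳 U b ∈ G) :
    ∀ (q : IBondY x.toKIdx) (v : 𝔸), ‖RVY x 𝔳 U q v‖ ≤ ‖v‖ :=
  fun q v => norm_R_le (hG1 _ (h𝔳 (ubondOfIdx x q))) (hG1 _ (G.inv_mem (h𝔳 (ubondOfIdx x q)))) v

/-- contraction of the inverse transports. [cite: Balaban1985BackgroundPropagators, p.390, bookkeeping] -/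
theorem norm_RVY_symm_le {G : Subgroup 𝔸ˣ} (hG1 : ∀ g ∈ G, ‖((g : 𝔸ˣ) : 𝔸)‖ ≤ 1) {𝔳 : AvY 𝔸 x} {U : CfgY 𝔸 x.toKIdx} (h𝔳 : ∀ b, 𝔳 U b ∈ G) :
    ∀ (q : IBondY x.toKIdx) (v : 𝔸), ‖(RVY x 𝔳 U q).symm v‖ ≤ ‖v‖ := by
  intro q v
  rw [RVY_symm_apply]
  have h1 := hG1 _ (G.inv_mem (h𝔳 (ubondOfIdx x q)))
  have h2 : ‖((((𝔳 U (ubondOfIdx x q))⁻¹)⁻¹ : 𝔸ˣ) : 𝔸)‖ ≤ 1 := by rw [inv_inv]; exact hG1 _ (h𝔳 _)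
  exact norm_R_le h1 h2 v

end Transport

/-! ## §5 The letters `μ` (3.169) and `D̄` (3.168) on NODE 00's carriers; the record -/

section Letters

variable {𝔸 : Type} [NormedRing 𝔸] [NormedAlgebra ℂ 𝔸] [CompleteSpace 𝔸]
variable (x : MemberY d ℓ hd hL b₀ b₁ Mstar)

/-- **THE PLACING OF UNIT SITES INTO NODE 00's SITE CARRIER**: a unit site `y ∈ T₁^{(k)}` is read at its CENTRE fine site (`embIter`), charted by
`boxEquiv` (print identifies `T₁^{(k)} ⊂ T_η`). [cite: Balaban1987RG1, (0.1) p.251 («lattice of centers»); Balaban1985BackgroundPropagators, p.427, dictionary] -/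
def repY (y : USiteY x) : SiteY x.toKIdx := boxEquiv x.hN (embIter x.k y)

/-- the placing is injective. [cite: Balaban1987RG1, (0.1) p.251, bookkeeping] -/
theorem repY_injective : Function.Injective (repY x) := by
  intro y y' h
  have h1 : embIter x.k y = embIter x.k y' := (boxEquiv x.hN).injective h
  rw [← iterBlockOf_embIter x.k x.hk y, ← iterBlockOf_embIter x.k x.hk y', h1]

/-- **RESTRICTION to the unit sites** `f ↦ f ∘ repY`. [cite: Balaban1985BackgroundPropagators, p.427, dictionary] -/
def readK : (SiteY x.toKIdx → 𝔸) →ₗ[ℂ] (USiteY x → 𝔸) := LinearMap.funLeft ℂ 𝔸 (repY x)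

omit [CompleteSpace 𝔸] in
/-- `readK` evaluated. [cite: Balaban1985BackgroundPropagators, p.427, bookkeeping] -/
@[simp] theorem readK_apply (f : SiteY x.toKIdx → 𝔸) (y : USiteY x) : readK x f y = f (repY x y) := rfl

open Classical in
/-- **EXTENSION BY ZERO from the unit sites** to NODE 00's site carrier. [cite: Balaban1985BackgroundPropagators, p.427, dictionary] -/
def placeK : (USiteY x → 𝔸) →ₗ[ℂ] (SiteY x.toKIdx → 𝔸) where
  toFun g z := if h : ∃ y, repY x y = z then g h.choose else 0
  map_add' g₁ g₂ := by
    funext z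
    by_cases h : ∃ y, repY x y = z
    · simp only [Pi.add_apply, dif_pos h]
    · simp only [Pi.add_apply, dif_neg h, add_zero]
  map_smul' c g := by
    funext z
    by_cases h : ∃ y, repY x y = z
    · simp only [Pi.smul_apply, dif_pos h, RingHom.id_apply]
    · simp only [Pi.smul_apply, dif_neg h, RingHom.id_apply, smul_zero]

omit [CompleteSpace 𝔸] in
/-- `placeK g` at a placed unit site is `g` there. [cite: Balaban1985BackgroundPropagators, p.427, bookkeeping] -/
@[simp] theorem placeK_repY (g : USiteY x → 𝔸) (y : USiteY x) : placeK x g (repY x y) = g y := by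
  classical
  have h : ∃ y', repY x y' = repY x y := ⟨y, rfl⟩
  show (if h : ∃ y', repY x y' = repY x y then g h.choose else 0) = g y
  rw [dif_pos h, repY_injective x h.choose_spec]

omit [CompleteSpace 𝔸] in
/-- `placeK g` vanishes off the placed unit sites. [cite: Balaban1985BackgroundPropagators, p.427, bookkeeping] -/
theorem placeK_of_not_range (g : USiteY x → 𝔸) {z : SiteY x.toKIdx} (h : ¬ ∃ y, repY x y = z) : placeK x g z = 0 := by
  classical
  show (if h : ∃ y', repY x y' = z then g h.choose else 0) = 0
  rw [dif_neg h]

omit [CompleteSpace 𝔸] in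
/-- restriction after extension is the identity. [cite: Balaban1985BackgroundPropagators, p.427, bookkeeping] -/
@[simp] theorem readK_placeK (g : USiteY x → 𝔸) : readK x (placeK x g) = g := by
  funext y; rw [readK_apply, placeK_repY]

variable (𝔳 : AvY 𝔸 x)

/-- ★ **THE LETTER `μ` OF (3.169)** as a function of the background: `B ↦ μ(B)`, bond functions on the index bonds → site functions on NODE 00's carrier
(the tree's `AxialFrame.mu` of the frame `axialFrameY x` with transports `R(V(b))`, placed at the block centres, zero elsewhere).
[cite: Balaban1985BackgroundPropagators, (3.169) p.430] -/
def muY (U : CfgY 𝔸 x.toKIdx) : (IBondY x.toKIdx → 𝔸) →ₗ[ℂ] (SiteY x.toKIdx → 𝔸) :=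
  placeK x ∘ₗ muCLin (RVY x 𝔳 U) (RVY_smulC x 𝔳 U) (axialFrameY x)

/-- ★ **THE LETTER `D̄ = D_V` OF (3.168)** as a function of the background: `μ ↦ D̄μ`, `(D̄μ)(b) = R(V(b))μ(b₊) − μ(b₋)` on the index bonds, `μ` read at the
block centres (the tree's `cod` with transports `R(V(b))`). [cite: Balaban1985BackgroundPropagators, (3.168) p.430, (3.3) p.390] -/
def DbarY (U : CfgY 𝔸 x.toKIdx) : (SiteY x.toKIdx → 𝔸) →ₗ[ℂ] (IBondY x.toKIdx → 𝔸) :=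
  codCLin (RVY x 𝔳 U) (RVY_smulC x 𝔳 U) (axialFrameY x).src (axialFrameY x).tgt ∘ₗ readK x

variable {x 𝔳}

/-- `μ(B)` at a placed unit site is the frame's `μ`. [cite: Balaban1985BackgroundPropagators, (3.169) p.430, bookkeeping] -/
@[simp] theorem muY_apply_repY (U : CfgY 𝔸 x.toKIdx) (B : IBondY x.toKIdx → 𝔸) (y : USiteY x) :
    muY x 𝔳 U B (repY x y) = (axialFrameY x).mu (RVY x 𝔳 U) B y := by
  simp [muY]

/-- `μ(B)` vanishes off the placed unit sites. [cite: Balaban1985BackgroundPropagators, (3.169) p.430, bookkeeping] -/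
theorem muY_apply_of_not_range (U : CfgY 𝔸 x.toKIdx) (B : IBondY x.toKIdx → 𝔸) {z : SiteY x.toKIdx} (h : ¬ ∃ y, repY x y = z) :
    muY x 𝔳 U B z = 0 := by
  simp only [muY, LinearMap.coe_comp, Function.comp_apply]
  exact placeK_of_not_range x _ h

/-- the restriction of `μ(B)` to the unit sites is the frame's `μ(B)`. [cite: Balaban1985BackgroundPropagators, (3.169) p.430, bookkeeping] -/
@[simp] theorem readK_muY (U : CfgY 𝔸 x.toKIdx) (B : IBondY x.toKIdx → 𝔸) : readK x (muY x 𝔳 U B) = (axialFrameY x).mu (RVY x 𝔳 U) B := by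
  funext y; rw [readK_apply, muY_apply_repY]

/-- **(3.168) EVALUATED**: `(D̄f)(b) = R(V(b)) f(b₊) − f(b₋)`. [cite: Balaban1985BackgroundPropagators, (3.168) p.430, (3.3) p.390] -/
theorem DbarY_apply (U : CfgY 𝔸 x.toKIdx) (f : SiteY x.toKIdx → 𝔸) (p : IBondY x.toKIdx) :
    DbarY x 𝔳 U f p = RVY x 𝔳 U p (f (repY x (utgt x p))) - f (repY x (usrc x p)) := by
  simp [DbarY]
  rfl

/-- `D̄` after `μ`: `D̄(μ(B)) = cod(μ(B))` of the frame. [cite: Balaban1985BackgroundPropagators, (3.168)–(3.169) p.430, bookkeeping] -/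
theorem DbarY_muY (U : CfgY 𝔸 x.toKIdx) (B : IBondY x.toKIdx → 𝔸) :
    DbarY x 𝔳 U (muY x 𝔳 U B) = cod (RVY x 𝔳 U) (axialFrameY x).src (axialFrameY x).tgt ((axialFrameY x).mu (RVY x 𝔳 U) B) := by
  simp only [DbarY, LinearMap.coe_comp, Function.comp_apply, readK_muY, codCLin_apply]

/-- ★ **`(1 + D̄μ)B = E(B)`**: the operator `1 + D̄μ` of (3.185) applied to `B` IS the tree's axial dressing `AxialFrame.dress` (`B + D̄μ(B)`, (3.169)).
[cite: Balaban1985BackgroundPropagators, (3.169) p.430, (3.185) p.432] -/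
theorem one_add_DbarY_muY (U : CfgY 𝔸 x.toKIdx) (B : IBondY x.toKIdx → 𝔸) :
    (1 + DbarY x 𝔳 U ∘ₗ muY x 𝔳 U) B = (axialFrameY x).dress (RVY x 𝔳 U) B := by
  rw [LinearMap.add_apply, Module.End.one_apply, LinearMap.coe_comp, Function.comp_apply, DbarY_muY]
  rfl

/-- `U = 1`, record transports: `D̄` is the plain covariant difference `f(b₊) − f(b₋)`. [cite: Balaban1985BackgroundPropagators, Cor. 3.5 p.407 (U = 1), bookkeeping] -/
theorem DbarY_one_apply (f : SiteY x.toKIdx → 𝔸) (p : IBondY x.toKIdx) :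
    DbarY x (avYOfRecord x) (fun _ _ => 1 : CfgY 𝔸 x.toKIdx) f p = f (repY x (utgt x p)) - f (repY x (usrc x p)) := by
  rw [DbarY_apply, RVY_avYOfRecord_one]

variable (x 𝔳)

/-- ★★ **THE SECT. E LETTER RECORD OF RECORD**: the parameter record `𝔢₀` with its `μ ∕ D̄` slots replaced by the GENUINE letters `muY ∕ DbarY` over the
averaged-field parameter `𝔳` (the transposes `μ* ∕ D̄*`, `Λ̃`, `C ∕ C*`, `⟨D̃⁽²⁾, J⟩`, `G̃₂` stay `𝔢₀`'s). [cite: Balaban1985BackgroundPropagators, (3.168)–(3.169) p.430, (3.185)–(3.186) p.432] -/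
def sectELettersYOfRecord (𝔢₀ : SectELettersY 𝔸 x) : SectELettersY 𝔸 x :=
  { 𝔢₀ with mu := muY x 𝔳, Dbar := DbarY x 𝔳 }

variable {x 𝔳}

/-- the record's `μ` is `muY`. [cite: Balaban1985BackgroundPropagators, (3.169) p.430, bookkeeping] -/
@[simp] theorem sectELettersYOfRecord_mu (𝔢₀ : SectELettersY 𝔸 x) : (sectELettersYOfRecord x 𝔳 𝔢₀).mu = muY x 𝔳 := rfl
/-- the record's `D̄` is `DbarY`. [cite: Balaban1985BackgroundPropagators, (3.168) p.430, bookkeeping] -/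
@[simp] theorem sectELettersYOfRecord_Dbar (𝔢₀ : SectELettersY 𝔸 x) : (sectELettersYOfRecord x 𝔳 𝔢₀).Dbar = DbarY x 𝔳 := rfl
/-- the record keeps `μ*`. [cite: Balaban1985BackgroundPropagators, (3.185) p.432, bookkeeping] -/
@[simp] theorem sectELettersYOfRecord_muT (𝔢₀ : SectELettersY 𝔸 x) : (sectELettersYOfRecord x 𝔳 𝔢₀).muT = 𝔢₀.muT := rfl
/-- the record keeps `D̄*`. [cite: Balaban1985BackgroundPropagators, (3.185) p.432, bookkeeping] -/
@[simp] theorem sectELettersYOfRecord_DbarT (𝔢₀ : SectELettersY 𝔸 x) : (sectELettersYOfRecord x 𝔳 𝔢₀).DbarT = 𝔢₀.DbarT := rfl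
/-- the record keeps `Λ̃`. [cite: Balaban1985BackgroundPropagators, (3.157) p.428, bookkeeping] -/
@[simp] theorem sectELettersYOfRecord_LamT (𝔢₀ : SectELettersY 𝔸 x) : (sectELettersYOfRecord x 𝔳 𝔢₀).LamT = 𝔢₀.LamT := rfl
/-- the record keeps `G̃₂`. [cite: Balaban1985BackgroundPropagators, (3.186) p.432, bookkeeping] -/
@[simp] theorem sectELettersYOfRecord_Gt2 (𝔢₀ : SectELettersY 𝔸 x) : (sectELettersYOfRecord x 𝔳 𝔢₀).Gt2 = 𝔢₀.Gt2 := rfl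
/-- the record keeps `C`. [cite: Balaban1985BackgroundPropagators, (3.157) p.428, bookkeeping] -/
@[simp] theorem sectELettersYOfRecord_elimC (𝔢₀ : SectELettersY 𝔸 x) : (sectELettersYOfRecord x 𝔳 𝔢₀).elimC = 𝔢₀.elimC := rfl
/-- the record keeps `C*`. [cite: Balaban1985BackgroundPropagators, (3.157) p.428, bookkeeping] -/
@[simp] theorem sectELettersYOfRecord_elimCt (𝔢₀ : SectELettersY 𝔸 x) : (sectELettersYOfRecord x 𝔳 𝔢₀).elimCt = 𝔢₀.elimCt := rfl
/-- the record keeps `⟨D̃⁽²⁾, J⟩`. [cite: Balaban1985BackgroundPropagators, (3.156) p.428, bookkeeping] -/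
@[simp] theorem sectELettersYOfRecord_D2J (𝔢₀ : SectELettersY 𝔸 x) : (sectELettersYOfRecord x 𝔳 𝔢₀).D2J = 𝔢₀.D2J := rfl

/-- ★ **THE LEFT OUTER FACTOR OF (3.185) AT THE RECORD, APPLIED**: `(P_Λ(1 + D̄μ)P_Λ)B = P_Λ E(P_Λ B)` with the frame's dressing `E`.
[cite: Balaban1985BackgroundPropagators, (3.185) p.432, (3.169) p.430] -/
theorem outerLY_ofRecord_apply (𝔢₀ : SectELettersY 𝔸 x) (U : CfgY 𝔸 x.toKIdx) (B : IBondY x.toKIdx → 𝔸) :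
    outerLY x (sectELettersYOfRecord x 𝔳 𝔢₀) U B = secΛY 𝔸 x ((axialFrameY x).dress (RVY x 𝔳 U) (secΛY 𝔸 x B)) := by
  show secΛY 𝔸 x ((1 + DbarY x 𝔳 U ∘ₗ muY x 𝔳 U) (secΛY 𝔸 x B)) = _
  rw [one_add_DbarY_muY]

end Letters

/-! ## §6 Record level: the Sect. E letters of record of a Stage 3′(Y) family -/

section Record

open scoped Matrix.Norms.L2Operator

/-- the averaged-field parameters of a family (one per member). [cite: Balaban1985BackgroundPropagators, (3.168) p.430, dictionary] -/
abbrev AvEY (N : ℕ) (θ : Stage3Params) (Mstar : ℕ) : Type :=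
  ∀ x : MemberY θ.d₆ θ.ℓ₆ θ.hd' θ.hL' θ.b₀ θ.b₁ Mstar, AvY (Matrix (Fin N) (Fin N) ℂ) x

/-- the averaged fields of record of a family. [cite: Balaban1985BackgroundPropagators, (3.40) p.397 + (3.168) p.430, dictionary] -/
def avEYOfRecord (N : ℕ) (θ : Stage3Params) (Mstar : ℕ) : AvEY N θ Mstar := fun x => avYOfRecord x

/-- ★★ **THE SECT. E LETTERS OF RECORD OF A FAMILY**: member by member, `sectELettersYOfRecord`. [cite: Balaban1985BackgroundPropagators, (3.168)–(3.169) p.430, (3.185) p.432] -/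
def sectEYOfRecord (N : ℕ) (θ : Stage3Params) (Mstar : ℕ) (𝔳 : AvEY N θ Mstar) (𝔢₀ : SectEY N θ Mstar) : SectEY N θ Mstar :=
  fun x => sectELettersYOfRecord x (𝔳 x) (𝔢₀ x)

/-- the family of record at a member. [cite: Balaban1985BackgroundPropagators, (3.169) p.430, bookkeeping] -/
@[simp] theorem sectEYOfRecord_apply (N : ℕ) (θ : Stage3Params) (Mstar : ℕ) (𝔳 : AvEY N θ Mstar) (𝔢₀ : SectEY N θ Mstar)
    (x : MemberY θ.d₆ θ.ℓ₆ θ.hd' θ.hL' θ.b₀ θ.b₁ Mstar) : sectEYOfRecord N θ Mstar 𝔳 𝔢₀ x = sectELettersYOfRecord x (𝔳 x) (𝔢₀ x) := rfl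

end Record

/-! ## §7 Locality faces: supports and kernel bounds of `μ`, `D̄`, and of the left outer factor `P_Λ(1 + D̄μ)P_Λ` -/

section Faces

variable {𝔸 : Type} [NormedRing 𝔸] [NormedAlgebra ℂ 𝔸] [CompleteSpace 𝔸]
variable {x : MemberY d ℓ hd hL b₀ b₁ Mstar} {𝔳 : AvY 𝔸 x}

open Classical in
omit [NormedAlgebra ℂ 𝔸] [CompleteSpace 𝔸] in
/-- the bond delta of NODE 00 is §1's `sglY`. [cite: Balaban1985BackgroundPropagators, (3.48) p.398, bookkeeping] -/
theorem deltaY_eq_sglY (q : IBondY x.toKIdx) (a : 𝔸) : (deltaY q a : IBondY x.toKIdx → 𝔸) = sglY q a := by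
  funext b
  unfold deltaY sglY
  by_cases h : b = q
  · rw [if_pos h, if_pos h]
  · rw [if_neg h, if_neg h]

/-- **SUPPORT OF `μ`**: `μ(δ_q ⊗ a)` vanishes at the placed unit site `y` unless `q` is an axial bond of the block of `y`.
[cite: Balaban1985BackgroundPropagators, (3.169) p.430 («μ is defined by the contours of the block»), bookkeeping] -/
theorem muY_deltaY_repY_eq_zero (U : CfgY 𝔸 x.toKIdx) {y : USiteY x} {q : IBondY x.toKIdx} (h : ¬ (axialFrameY x).InAx y q) (a : 𝔸) :
    muY x 𝔳 U (deltaY q a) (repY x y) = 0 := by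
  classical
  rw [muY_apply_repY]
  have h0 : (axialFrameY x).mu (RVY x 𝔳 U) (0 : IBondY x.toKIdx → 𝔸) y = 0 := congr_fun (map_zero ((axialFrameY x).muLin (RVY x 𝔳 U))) y
  rw [← h0]
  refine (axialFrameY x).mu_congr (RVY x 𝔳 U) fun b hb => ?_
  rw [deltaY_eq_sglY, sglY_apply, Pi.zero_apply, if_neg]
  rintro rfl
  exact h hb

open Classical in
/-- the `μ`-WEIGHTS: occurrence counts of `q` in the contours of the block of the unit site placed at `s` (zero off the placed sites).
[cite: Balaban1985BackgroundPropagators, (3.169) p.430, bookkeeping] -/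
def muWtY (x : MemberY d ℓ hd hL b₀ b₁ Mstar) (s : SiteY x.toKIdx) (q : IBondY x.toKIdx) : ℝ :=
  if h : ∃ y, repY x y = s then axOccY (axialFrameY x) h.choose q else 0

/-- **KERNEL BOUND OF `μ`**: `‖μ(δ_q ⊗ a)(s)‖ ≤ w^μ_{sq}‖a‖` for a norm-one structure group and `G`-valued `V`.
[cite: Balaban1985BackgroundPropagators, (3.169) p.430 + p.390 (|R(V)·| = |·|), bookkeeping] -/
theorem norm_muY_deltaY_le {G : Subgroup 𝔸ˣ} (hG1 : ∀ g ∈ G, ‖((g : 𝔸ˣ) : 𝔸)‖ ≤ 1) {U : CfgY 𝔸 x.toKIdx} (h𝔳 : ∀ b, 𝔳 U b ∈ G)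
    (s : SiteY x.toKIdx) (q : IBondY x.toKIdx) (a : 𝔸) : ‖muY x 𝔳 U (deltaY q a) s‖ ≤ muWtY x s q * ‖a‖ := by
  classical
  unfold muWtY
  by_cases h : ∃ y, repY x y = s
  · rw [dif_pos h]
    obtain ⟨y, rfl⟩ := id h
    have e : h.choose = y := repY_injective x h.choose_spec
    rw [e, muY_apply_repY, deltaY_eq_sglY]
    exact norm_mu_sgl_le (RVY x 𝔳 U) (axialFrameY x) (norm_RVY_le x hG1 h𝔳) (norm_RVY_symm_le x hG1 h𝔳) q a y
  · rw [dif_neg h, muY_apply_of_not_range U _ h, norm_zero, zero_mul]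

/-- **ROW MASS OF `μ`**: `Σ_q w^μ_{sq} ≤ 2(d+1)ℓ` (contours have length `≤ (d+1)ℓ`). [cite: Balaban1985BackgroundPropagators, (3.169) p.430; Balaban1985Averaging, p.24, bookkeeping] -/
theorem sum_muWtY_le (s : SiteY x.toKIdx) : ∑ q, muWtY x s q ≤ 2 * (((d + 1) * ℓ : ℕ) : ℝ) := by
  classical
  unfold muWtY
  by_cases h : ∃ y, repY x y = s
  · simp only [dif_pos h]
    exact sum_axOccY_le (axialFrameY x) (length_uΓ_le x) h.choose
  · simp only [dif_neg h, Finset.sum_const_zero]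
    positivity

/-- **SUPPORT OF `D̄`**: `D̄(δ_s ⊗ a)(p)` vanishes unless `s` is the placed `b₊` or `b₋` of `p`. [cite: Balaban1985BackgroundPropagators, (3.168) p.430, bookkeeping] -/
theorem DbarY_deltaY_eq_zero (U : CfgY 𝔸 x.toKIdx) {s : SiteY x.toKIdx} {p : IBondY x.toKIdx} (ht : s ≠ repY x (utgt x p)) (hs : s ≠ repY x (usrc x p))
    (a : 𝔸) : DbarY x 𝔳 U (deltaY s a) p = 0 := by
  classical
  rw [DbarY_apply]
  unfold deltaY
  rw [if_neg (fun h => ht h.symm), if_neg (fun h => hs h.symm), map_zero, sub_zero]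

open Classical in
/-- the `D̄`-WEIGHTS: `1` at the placed ends of `p`. [cite: Balaban1985BackgroundPropagators, (3.168) p.430, bookkeeping] -/
def DbarWtY (x : MemberY d ℓ hd hL b₀ b₁ Mstar) (p : IBondY x.toKIdx) (s : SiteY x.toKIdx) : ℝ :=
  (if s = repY x (utgt x p) then 1 else 0) + (if s = repY x (usrc x p) then 1 else 0)

/-- **KERNEL BOUND OF `D̄`**: `‖D̄(δ_s ⊗ a)(p)‖ ≤ w^D_{ps}‖a‖` (norm-one `G`, `G`-valued `V`). [cite: Balaban1985BackgroundPropagators, (3.168) p.430, bookkeeping] -/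
theorem norm_DbarY_deltaY_le {G : Subgroup 𝔸ˣ} (hG1 : ∀ g ∈ G, ‖((g : 𝔸ˣ) : 𝔸)‖ ≤ 1) {U : CfgY 𝔸 x.toKIdx} (h𝔳 : ∀ b, 𝔳 U b ∈ G)
    (p : IBondY x.toKIdx) (s : SiteY x.toKIdx) (a : 𝔸) : ‖DbarY x 𝔳 U (deltaY s a) p‖ ≤ DbarWtY x p s * ‖a‖ := by
  classical
  rw [DbarY_apply, DbarWtY, add_mul]
  refine (norm_sub_le _ _).trans (add_le_add ?_ ?_)
  · refine (norm_RVY_le x hG1 h𝔳 p _).trans ?_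
    unfold deltaY
    by_cases h : repY x (utgt x p) = s
    · rw [if_pos h, if_pos h.symm, one_mul]
    · rw [if_neg h, if_neg (fun h' => h h'.symm), norm_zero, zero_mul]
  · unfold deltaY
    by_cases h : repY x (usrc x p) = s
    · rw [if_pos h, if_pos h.symm, one_mul]
    · rw [if_neg h, if_neg (fun h' => h h'.symm), norm_zero, zero_mul]

omit [CompleteSpace 𝔸] in
/-- **ROW MASS OF `D̄`**: `Σ_s w^D_{ps} ≤ 2`. [cite: Balaban1985BackgroundPropagators, (3.168) p.430, bookkeeping] -/
theorem sum_DbarWtY_le (p : IBondY x.toKIdx) : ∑ s, DbarWtY x p s ≤ 2 := by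
  classical
  unfold DbarWtY
  rw [Finset.sum_add_distrib, Finset.sum_ite_eq' Finset.univ (repY x (utgt x p)), Finset.sum_ite_eq' Finset.univ (repY x (usrc x p))]
  simp only [Finset.mem_univ, if_true]
  norm_num

variable [FiniteDimensional ℂ 𝔸]

omit [CompleteSpace 𝔸] in
/-- the blocks of a sector sandwich are dominated by the blocks of the middle operator. [cite: Balaban1985BackgroundPropagators, (3.185) p.432 (P_Λ … P_Λ), bookkeeping] -/
theorem norm_blockCLM_secΛ_sandwich_apply_le (T : Module.End ℂ (IBondY x.toKIdx → 𝔸)) (p q : IBondY x.toKIdx) (a : 𝔸) :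
    ‖blockCLM (secΛY 𝔸 x * T * secΛY 𝔸 x) p q a‖ ≤ ‖T (deltaY q a) p‖ := by
  classical
  rw [blockCLM_apply]
  show ‖secΛY 𝔸 x (T (secΛY 𝔸 x (deltaY q a))) p‖ ≤ _
  have hq : secΛY 𝔸 x (deltaY q a) = if inΛY x q then deltaY q a else 0 := by
    funext b
    unfold secΛY
    by_cases hb : inΛY x b
    · rw [secY_apply_of hb]
      by_cases hq : inΛY x q
      · rw [if_pos hq]
      · rw [if_neg hq]
        unfold deltaY
        rw [if_neg]
        · rfl
        · rintro rfl; exact hq hb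
    · rw [secY_apply_of_not hb]
      by_cases hq : inΛY x q
      · rw [if_pos hq]; unfold deltaY; rw [if_neg]; rintro rfl; exact hb hq
      · rw [if_neg hq]; rfl
  rw [hq]
  unfold secΛY
  by_cases hp : inΛY x p
  · rw [secY_apply_of hp]
    by_cases hq' : inΛY x q
    · rw [if_pos hq']
    · rw [if_neg hq', map_zero, Pi.zero_apply, norm_zero]; exact norm_nonneg _
  · rw [secY_apply_of_not hp, norm_zero]; exact norm_nonneg _

/-- **SUPPORT OF THE LEFT OUTER FACTOR** `P_Λ(1 + D̄μ)P_Λ` at the record: its `(p,q)` block vanishes unless `q = p` or `q` is an axial bond of the block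
of `b₋` or of `b₊` of `p` (finite range: one `L`-block). [cite: Balaban1985BackgroundPropagators, (3.185) p.432, (3.168)–(3.169) p.430] -/
theorem blockCLM_outerLY_eq_zero (𝔢₀ : SectELettersY 𝔸 x) (U : CfgY 𝔸 x.toKIdx) {p q : IBondY x.toKIdx} (hqp : q ≠ p)
    (hs : ¬ (axialFrameY x).InAx (usrc x p) q) (ht : ¬ (axialFrameY x).InAx (utgt x p) q) :
    blockCLM (outerLY x (sectELettersYOfRecord x 𝔳 𝔢₀) U) p q = 0 := by
  classical
  refine ContinuousLinearMap.ext fun a => ?_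
  rw [show (0 : 𝔸 →L[ℂ] 𝔸) a = 0 from rfl, ← norm_le_zero_iff]
  refine (norm_blockCLM_secΛ_sandwich_apply_le _ p q a).trans (le_of_eq ?_)
  rw [norm_eq_zero, sectELettersYOfRecord_Dbar, sectELettersYOfRecord_mu, one_add_DbarY_muY, deltaY_eq_sglY]
  exact dress_sgl_eq_zero (RVY x 𝔳 U) (axialFrameY x) hqp hs ht a

/-- ★ **ROW MASS OF THE LEFT OUTER FACTOR** `P_Λ(1 + D̄μ)P_Λ` at the record: `Σ_q ‖(P_Λ(1 + D̄μ)P_Λ)_{pq}‖ ≤ 1 + 4(d+1)ℓ` for a norm-one structure group and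
`G`-valued `V` (the `rowMassL` face of `B9Thm315WholeSectERep.LocalOuterY`, with a constant depending on `d, L` only).
[cite: Balaban1985BackgroundPropagators, (3.185) p.432, (3.168)–(3.169) p.430] -/
theorem rowMass_outerLY_le {G : Subgroup 𝔸ˣ} (hG1 : ∀ g ∈ G, ‖((g : 𝔸ˣ) : 𝔸)‖ ≤ 1) (𝔢₀ : SectELettersY 𝔸 x) {U : CfgY 𝔸 x.toKIdx}
    (h𝔳 : ∀ b, 𝔳 U b ∈ G) (p : IBondY x.toKIdx) :
    ∑ q, ‖blockCLM (outerLY x (sectELettersYOfRecord x 𝔳 𝔢₀) U) p q‖ ≤ 1 + 4 * (((d + 1) * ℓ : ℕ) : ℝ) := by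
  classical
  have hb : ∀ q, ‖blockCLM (outerLY x (sectELettersYOfRecord x 𝔳 𝔢₀) U) p q‖ ≤ dressWtY (axialFrameY x) p q := by
    intro q
    refine ContinuousLinearMap.opNorm_le_bound _ (dressWtY_nonneg _ p q) fun a => ?_
    · refine (norm_blockCLM_secΛ_sandwich_apply_le _ p q a).trans ?_
      rw [sectELettersYOfRecord_Dbar, sectELettersYOfRecord_mu, one_add_DbarY_muY, deltaY_eq_sglY]
      exact norm_dress_sgl_le (RVY x 𝔳 U) (axialFrameY x) (norm_RVY_le x hG1 h𝔳) (norm_RVY_symm_le x hG1 h𝔳) p q a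
  exact (Finset.sum_le_sum fun q _ => hb q).trans (sum_dressWtY_le (axialFrameY x) (length_uΓ_le x) p)

end Faces


/-! ## §8 Metric currency: the `μ ∕ D̄`-side hypotheses of `B9Thm315WholeBlocksRect.localOuterY_of_letters` at the record -/

section Metric

/-- **A COORDINATE BOUND FOR p21's `|y − y′|` ON `T^{(k)}`**: if in every direction the two `k`-block labels differ by at most `n` modulo the period
`L·M_h·P_μ` of `T^{(k)}`, then `|y − y′| ≤ n` (torus sup-distance of the block centres in units of `L^k`).
[cite: Balaban1985BackgroundPropagators, (3.154) p.427, (3.187) p.432, dictionary] -/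
theorem tdistK_le_of_coords {Mh k : ℕ} {P : Fin (d + 1) → ℕ} (hMP : ∀ μ, 1 ≤ Mh * P μ) {β β' : Fin (d + 1) → ℤ} {n : ℝ} (hn : 0 ≤ n)
    (h : ∀ μ, ∃ m : ℤ, |(((β' μ - β μ - m * (((ℓ + 1) * (Mh * P μ) : ℕ) : ℤ) : ℤ)) : ℝ)| ≤ n) :
    tdistK (ℓ := ℓ) (Mh := Mh) (k := k) (P := P) β β' ≤ n := by
  unfold tdistK
  have hLk : (0 : ℝ) < (((ℓ + 1) ^ k : ℕ) : ℝ) := by positivity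
  rw [div_le_iff₀ hLk]
  refine (dist_pi_le_iff (by positivity)).2 fun μ => ?_
  obtain ⟨m, hm⟩ := h μ
  have hN1 : 1 ≤ N0 ℓ Mh k P μ :=
    Nat.one_le_iff_ne_zero.2 (Nat.mul_ne_zero (pow_ne_zero _ (Nat.succ_ne_zero ℓ))
      (Nat.mul_ne_zero (Nat.succ_ne_zero ℓ) (Nat.one_le_iff_ne_zero.1 (hMP μ))))
  have hN0 : ((N0 ℓ Mh k P μ : ℕ) : ℝ) ≠ 0 := by exact_mod_cast Nat.one_le_iff_ne_zero.1 hN1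
  rw [dist_comm, dist_eq_norm]
  calc ‖toT (N0 ℓ Mh k P) (cenLab ((ℓ + 1) ^ k) β') μ - toT (N0 ℓ Mh k P) (cenLab ((ℓ + 1) ^ k) β) μ‖
      = ‖(((cenLab ((ℓ + 1) ^ k) β' μ - cenLab ((ℓ + 1) ^ k) β μ : ℝ)) : AddCircle ((N0 ℓ Mh k P μ : ℕ) : ℝ))‖ := by
        rw [toT, toT, ← AddCircle.coe_sub]
    _ ≤ |(cenLab ((ℓ + 1) ^ k) β' μ - cenLab ((ℓ + 1) ^ k) β μ : ℝ) - m * ((N0 ℓ Mh k P μ : ℕ) : ℝ)| :=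
        norm_coe_le_abs_sub_mul hN0 _ m
    _ = |(((ℓ + 1) ^ k : ℕ) : ℝ) * ((((β' μ - β μ - m * (((ℓ + 1) * (Mh * P μ) : ℕ) : ℤ) : ℤ)) : ℝ))| := by
        congr 1
        simp only [cenLab, N0]
        push_cast
        ring
    _ = (((ℓ + 1) ^ k : ℕ) : ℝ) * |(((β' μ - β μ - m * (((ℓ + 1) * (Mh * P μ) : ℕ) : ℤ) : ℤ)) : ℝ)| := by
        rw [abs_mul, abs_of_pos hLk]
    _ ≤ (((ℓ + 1) ^ k : ℕ) : ℝ) * n := mul_le_mul_of_nonneg_left hm hLk.le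
    _ = n * (((ℓ + 1) ^ k : ℕ) : ℝ) := mul_comm _ _

variable (x : MemberY d ℓ hd hL b₀ b₁ Mstar)

/-- `M_h·P′_μ ≥ 1` at a member. [cite: Balaban1984PropagatorsII, (2.1) p.224, bookkeeping] -/
theorem one_le_Mh_mul_P (μ : Fin (d + 1)) : 1 ≤ x.Mh * x.P' μ :=
  Nat.one_le_iff_ne_zero.2 (Nat.mul_ne_zero (by have := x.hM8; omega) (by have := x.hP5 μ; omega))

/-- labels of the inverse chart are the residues. [cite: Balaban1984PropagatorsII, (2.1) p.224, bookkeeping] -/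
theorem labK_ofZ_emod (w : Fin (d + 1) → ℤ) (μ : Fin (d + 1)) :
    labK x (ofZ x w) μ = w μ % (((PV d ℓ x.m x.K hd hL).sitesPerDir x.k : ℕ) : ℤ) := by
  simp only [labK, ofZ]
  rw [ZMod.val_intCast]

/-- **TWO CHARTED UNIT SITES WHOSE INTEGER LABELS DIFFER BY AT MOST `n` ARE AT `|y − y′| ≤ n`** (the reduction modulo the period is absorbed by
the torus distance). [cite: Balaban1985BackgroundPropagators, (3.187) p.432, dictionary] -/
theorem tdistK_labK_ofZ_le {w w' : Fin (d + 1) → ℤ} {n : ℝ} (hn : 0 ≤ n) (h : ∀ μ, |(((w' μ - w μ : ℤ)) : ℝ)| ≤ n) :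
    tdistK (ℓ := ℓ) (Mh := x.Mh) (k := x.k) (P := x.P') (labK x (ofZ x w)) (labK x (ofZ x w')) ≤ n := by
  refine tdistK_le_of_coords (one_le_Mh_mul_P x) hn fun μ => ?_
  set N : ℤ := (((PV d ℓ x.m x.K hd hL).sitesPerDir x.k : ℕ) : ℤ) with hN
  have hNμ : (((ℓ + 1) * (x.Mh * x.P' μ) : ℕ) : ℤ) = N := by rw [hN, sitesPerDir_k x μ]
  refine ⟨w μ / N - w' μ / N, ?_⟩
  have e : labK x (ofZ x w') μ - labK x (ofZ x w) μ - (w μ / N - w' μ / N) * (((ℓ + 1) * (x.Mh * x.P' μ) : ℕ) : ℤ) = w' μ - w μ := by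
    rw [hNμ, labK_ofZ_emod, labK_ofZ_emod, ← hN, Int.emod_def, Int.emod_def]
    ring
  rw [e]
  exact h μ

/-- **ONE LATTICE STEP**: `|y − (y + e_μ)| ≤ 1` on `T₁^{(k)}`. [cite: Balaban1985BackgroundPropagators, (3.168) p.430, (3.187) p.432, bookkeeping] -/
theorem tdistK_labK_shift_le (y : USiteY x) (μ : Fin (d + 1)) :
    tdistK (ℓ := ℓ) (Mh := x.Mh) (k := x.k) (P := x.P') (labK x y) (labK x (y.shift μ)) ≤ 1 := by
  have h := tdistK_labK_ofZ_le x (w := labK x y) (w' := labK x y + unitVec μ) zero_le_one fun ν => by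
    rw [Pi.add_apply, add_sub_cancel_left, unitVec_apply]
    split <;> simp
  rwa [ofZ_add_unitVec, ofZ_labK] at h

/-- **TWO UNIT SITES OF ONE `L`-BLOCK**: `|y − y′| ≤ ℓ = L − 1`. [cite: Balaban1985BackgroundPropagators, (3.169) p.430, (3.187) p.432, bookkeeping] -/
theorem tdistK_labK_le_of_mem_block {y : USiteY x} {z c : Fin (d + 1) → ℤ} (hy : labK x y ∈ B6Elimination.block (ℓ + 1) c)
    (hz : z ∈ B6Elimination.block (ℓ + 1) c) :
    tdistK (ℓ := ℓ) (Mh := x.Mh) (k := x.k) (P := x.P') (labK x y) (labK x (ofZ x z)) ≤ ℓ := by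
  have h := tdistK_labK_ofZ_le x (w := labK x y) (w' := z) (Nat.cast_nonneg ℓ) fun μ => by
    obtain ⟨h1, h2⟩ := (mem_block.1 hy) μ
    obtain ⟨h1', h2'⟩ := (mem_block.1 hz) μ
    have : |z μ - labK x y μ| ≤ (ℓ : ℤ) := abs_le.2 ⟨by push_cast at h2 ⊢; omega, by push_cast at h2' ⊢; omega⟩
    exact_mod_cast this
  rwa [ofZ_labK] at h

/-- **THE `k`-LABEL OF AN INDEX BOND IS THE LABEL OF `b₋` OR OF `b₊`** (def-Y's `kLab` = `k`-block of the base end-point).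
[cite: Balaban1985BackgroundPropagators, (3.154) p.427 + (3.168) p.430, dictionary] -/
theorem kLab_eq_labK_or (p : IBondY x.toKIdx) : kLab x p = labK x (usrc x p) ∨ kLab x p = labK x (utgt x p) := by
  have h1 : kLab x p = labK x (iterBlockOf x.k (baseSite x.hN x.D x.hk p)) := blk_toBox x.hN x.hk _
  have h2 : iterBlockOf x.k (baseSite x.hN x.D x.hk p) = iterBlockOf x.k (embIter (lvl x.hN x.D x.hk p) (base x.hN x.D x.hk p)) :=
    iterBlockOf_eq_of_le (lvl_le x.hN x.D x.hk p)
      (by rw [iterBlockOf_baseSite, iterBlockOf_embIter _ (lvl_le_mK x.hN x.D x.hk p)])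
  rw [h1, h2]
  unfold base
  split_ifs
  · exact Or.inl rfl
  · exact Or.inr rfl

/-- **THE `k`-BLOCKS OF THE TWO ENDS OF A LEVEL-`j` BOND ARE EQUAL OR NEIGHBOURS** (`j ≤ n ≤ m + K`; iterate of `B10StarCount.blockOf_shift`).
[cite: Balaban1984PropagatorsI, (1.6) p.18, (1.18) p.20, bookkeeping] -/
theorem iterBlockOf_embIter_shift_or {P : Params} {j : ℕ} (s : Site P j) (μ : Fin P.d) :
    ∀ n, j ≤ n → n ≤ P.m + P.K →
      iterBlockOf n (embIter j (s.shift μ)) = iterBlockOf n (embIter j s) ∨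
        iterBlockOf n (embIter j (s.shift μ)) = (iterBlockOf n (embIter j s)).shift μ := by
  intro n hjn
  induction n, hjn using Nat.le_induction with
  | base => intro hj; rw [iterBlockOf_embIter j hj, iterBlockOf_embIter j hj]; exact Or.inr rfl
  | succ n hjn ih =>
    intro hn
    rcases ih (by omega) with e | e
    · left; rw [iterBlockOf_succ, iterBlockOf_succ, e]
    · rw [iterBlockOf_succ, iterBlockOf_succ, e, blockOf_shift (by omega) _ μ]
      split_ifs
      · exact Or.inr rfl
      · exact Or.inl rfl

/-- **`b₊ = b₋` OR `b₊ = b₋ + e_μ` ON THE UNIT LATTICE** for every index bond. [cite: Balaban1985BackgroundPropagators, (3.168) p.430, bookkeeping] -/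
theorem utgt_eq_or_shift (p : IBondY x.toKIdx) : utgt x p = usrc x p ∨ utgt x p = (usrc x p).shift p.1.2.dir :=
  iterBlockOf_embIter_shift_or p.1.2.src p.1.2.dir x.k (Nat.lt_succ_iff.1 p.1.1.isLt) x.hk

/-- `|b₋ − b₊| ≤ 1`. [cite: Balaban1985BackgroundPropagators, (3.168) p.430, bookkeeping] -/
theorem tdistK_usrc_utgt_le (p : IBondY x.toKIdx) :
    tdistK (ℓ := ℓ) (Mh := x.Mh) (k := x.k) (P := x.P') (labK x (usrc x p)) (labK x (utgt x p)) ≤ 1 := by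
  rcases utgt_eq_or_shift x p with e | e
  · rw [e, tdistK_self]; exact zero_le_one
  · rw [e]; exact tdistK_labK_shift_le x _ _

/-- `|kLab p − b₋| ≤ 1` and `|kLab p − b₊| ≤ 1`. [cite: Balaban1985BackgroundPropagators, (3.154) p.427, bookkeeping] -/
theorem tdistK_kLab_usrc_le (p : IBondY x.toKIdx) :
    tdistK (ℓ := ℓ) (Mh := x.Mh) (k := x.k) (P := x.P') (kLab x p) (labK x (usrc x p)) ≤ 1 ∧
      tdistK (ℓ := ℓ) (Mh := x.Mh) (k := x.k) (P := x.P') (kLab x p) (labK x (utgt x p)) ≤ 1 := by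
  rcases kLab_eq_labK_or x p with e | e <;> rw [e]
  · exact ⟨by rw [tdistK_self]; exact zero_le_one, tdistK_usrc_utgt_le x p⟩
  · exact ⟨by rw [tdistK_comm]; exact tdistK_usrc_utgt_le x p, by rw [tdistK_self]; exact zero_le_one⟩

/-- **THE SITE PLACING `πS`** for `localOuterY_of_letters`: a point of NODE 00's site carrier ↦ the label of its `k`-block. [cite: Balaban1985BackgroundPropagators, (3.187) p.432, dictionary] -/
def πSY (s : SiteY x.toKIdx) : Fin (d + 1) → ℤ := blk ((ℓ + 1) ^ x.k) s.1

/-- the placed unit site `y` sits at its own label. [cite: Balaban1985BackgroundPropagators, (3.187) p.432, bookkeeping] -/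
@[simp] theorem πSY_repY (y : USiteY x) : πSY x (repY x y) = labK x y := by
  have h : πSY x (repY x y) = labK x (iterBlockOf x.k (embIter x.k y)) := blk_toBox x.hN x.hk _
  rw [h, iterBlockOf_embIter x.k x.hk]

/-- **AXIAL BONDS LIE IN THE BLOCK**: if `q` is axial for the block of `y` then `y` and `b₋(q)` are unit sites of one `L`-block.
[cite: Balaban1985BackgroundPropagators, (3.169) p.430; Balaban1985Averaging, p.24, bookkeeping] -/
theorem exists_block_of_inAx {y : USiteY x} {q : IBondY x.toKIdx} (h : (axialFrameY x).InAx y q) :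
    ∃ c z : Fin (d + 1) → ℤ, labK x y ∈ B6Elimination.block (ℓ + 1) c ∧ z ∈ B6Elimination.block (ℓ + 1) c ∧ usrc x q = ofZ x z := by
  obtain ⟨y', hblk, hq⟩ := h
  change ublk x y' = ublk x y at hblk
  change q ∈ uΓ x y' at hq
  by_cases hy' : GoodY x y'
  swap
  · rw [uΓ_of_not_good x hy'] at hq; exact absurd hq (List.not_mem_nil)
  have hy : GoodY x y := by
    by_contra hy
    rw [ublk_of_good x hy', ublk_of_not_good x hy] at hblk
    exact hy (hblk ▸ goodY_ucorner x hy')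
  rw [ublk_of_good x hy', ublk_of_good x hy] at hblk
  have hc : corner (ℓ + 1) (labK x y) = corner (ℓ + 1) (labK x y') := by
    rw [← labK_ucorner, ← labK_ucorner, hblk]
  unfold uΓ at hq
  rw [dif_pos hy', List.mem_pmap] at hq
  obtain ⟨b, hb, rfl⟩ := hq
  refine ⟨corner (ℓ + 1) (labK x y'), b.1, ?_, mem_block_of_mem_comb x y' hb, usrc_idxOfU x _ _⟩
  rw [← hc]
  exact mem_block_corner (by exact_mod_cast ell_succ_pos) _

variable {x}
variable {𝔸 : Type} [NormedRing 𝔸] [NormedAlgebra ℂ 𝔸] [CompleteSpace 𝔸] [FiniteDimensional ℂ 𝔸] {𝔳 : AvY 𝔸 x}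

/-- **`m_D = 2`**: the row masses of the blocks of `D̄` (norm-one `G`, `G`-valued `V`). [cite: Balaban1985BackgroundPropagators, (3.168) p.430, bookkeeping] -/
theorem rowMass₂_DbarY_le {G : Subgroup 𝔸ˣ} (hG1 : ∀ g ∈ G, ‖((g : 𝔸ˣ) : 𝔸)‖ ≤ 1) {U : CfgY 𝔸 x.toKIdx} (h𝔳 : ∀ b, 𝔳 U b ∈ G)
    (p : IBondY x.toKIdx) : ∑ s, ‖blockCLM₂ (DbarY x 𝔳 U) p s‖ ≤ 2 := by
  classical
  refine (Finset.sum_le_sum fun s _ => ?_).trans (sum_DbarWtY_le (x := x) p)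
  refine ContinuousLinearMap.opNorm_le_bound _ ?_ fun a => ?_
  · unfold DbarWtY; positivity
  · rw [blockCLM₂_apply]; exact norm_DbarY_deltaY_le hG1 h𝔳 p s a

/-- **`m_μ = 2(d+1)ℓ`**: the row masses of the blocks of `μ`. [cite: Balaban1985BackgroundPropagators, (3.169) p.430, bookkeeping] -/
theorem rowMass₂_muY_le {G : Subgroup 𝔸ˣ} (hG1 : ∀ g ∈ G, ‖((g : 𝔸ˣ) : 𝔸)‖ ≤ 1) {U : CfgY 𝔸 x.toKIdx} (h𝔳 : ∀ b, 𝔳 U b ∈ G)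
    (s : SiteY x.toKIdx) : ∑ q, ‖blockCLM₂ (muY x 𝔳 U) s q‖ ≤ 2 * (((d + 1) * ℓ : ℕ) : ℝ) := by
  classical
  refine (Finset.sum_le_sum fun q _ => ?_).trans (sum_muWtY_le (x := x) s)
  refine ContinuousLinearMap.opNorm_le_bound _ ?_ fun a => ?_
  · unfold muWtY; split
    · exact axOccY_nonneg _ _ _
    · exact le_rfl
  · rw [blockCLM₂_apply]; exact norm_muY_deltaY_le hG1 h𝔳 s q a

/-- **`r_D = 1`**: a non-zero block `(p, s)` of `D̄` has `s` at the placed `b₊` or `b₋` of `p`, within `|·| ≤ 1` of `kLab p`.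
[cite: Balaban1985BackgroundPropagators, (3.168) p.430, (3.187) p.432, bookkeeping] -/
theorem range₂_DbarY_le (U : CfgY 𝔸 x.toKIdx) {p : IBondY x.toKIdx} {s : SiteY x.toKIdx} (h : blockCLM₂ (DbarY x 𝔳 U) p s ≠ 0) :
    tdistK (ℓ := ℓ) (Mh := x.Mh) (k := x.k) (P := x.P') (kLab x p) (πSY x s) ≤ 1 := by
  classical
  have hs : s = repY x (utgt x p) ∨ s = repY x (usrc x p) := by
    by_contra hne
    rw [not_or] at hne
    exact h (ContinuousLinearMap.ext fun a => by rw [blockCLM₂_apply, DbarY_deltaY_eq_zero U hne.1 hne.2]; rfl)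
  rcases hs with rfl | rfl <;> rw [πSY_repY]
  · exact (tdistK_kLab_usrc_le x p).2
  · exact (tdistK_kLab_usrc_le x p).1

/-- **`r_μ = ℓ + 1`**: a non-zero block `(s, q)` of `μ` has `s` a placed unit site `y` with `q` axial for the block of `y`, so `|y − kLab q| ≤ ℓ + 1`.
[cite: Balaban1985BackgroundPropagators, (3.169) p.430, (3.187) p.432, bookkeeping] -/
theorem range₂_muY_le (U : CfgY 𝔸 x.toKIdx) {s : SiteY x.toKIdx} {q : IBondY x.toKIdx} (h : blockCLM₂ (muY x 𝔳 U) s q ≠ 0) :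
    tdistK (ℓ := ℓ) (Mh := x.Mh) (k := x.k) (P := x.P') (πSY x s) (kLab x q) ≤ ℓ + 1 := by
  classical
  have hs : ∃ y, repY x y = s := by
    by_contra hne
    exact h (ContinuousLinearMap.ext fun a => by rw [blockCLM₂_apply, muY_apply_of_not_range U _ hne]; rfl)
  obtain ⟨y, rfl⟩ := hs
  have hq : (axialFrameY x).InAx y q := by
    by_contra hq
    exact h (ContinuousLinearMap.ext fun a => by rw [blockCLM₂_apply, muY_deltaY_repY_eq_zero U hq]; rfl)
  obtain ⟨c, z, hy, hz, e⟩ := exists_block_of_inAx x hq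
  rw [πSY_repY]
  have h1 : tdistK (ℓ := ℓ) (Mh := x.Mh) (k := x.k) (P := x.P') (labK x y) (labK x (usrc x q)) ≤ ℓ := by
    rw [e]; exact tdistK_labK_le_of_mem_block x hy hz
  have h2 := (tdistK_kLab_usrc_le x q).1
  rw [tdistK_comm] at h2
  linarith [tdistK_triangle (ℓ := ℓ) (Mh := x.Mh) (k := x.k) (P := x.P') (labK x y) (labK x (usrc x q)) (kLab x q)]

/-- ★★ **`LocalOuterY` AT THE RECORD**: for a norm-one structure group and `G`-valued `V`, given the four letter-level facts of the PARAMETER's right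
letters `μ* = 𝔢₀.muT`, `D̄* = 𝔢₀.DbarT` (ranges `r_{μ*}, r_{D*}` along `πSY`, column masses `m_{μ*} ≥ 0`, `m_{D*}`), n06-m's `LocalOuterY` holds for
the record `sectELettersYOfRecord x 𝔳 𝔢₀` with `r = max 0 (max (ℓ + 2) (r_{μ*} + r_{D*}))`, `m_E = 1 + 4(d+1)ℓ`, `m_F = 1 + m_{μ*}m_{D*}`
(`localOuterY_of_letters` with `r_D = 1`, `m_D = 2`, `r_μ = ℓ + 1`, `m_μ = 2(d+1)ℓ`). [cite: Balaban1985BackgroundPropagators, (3.185) p.432, (3.168)–(3.169) p.430] -/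
theorem localOuterY_ofRecord {G : Subgroup 𝔸ˣ} (hG1 : ∀ g ∈ G, ‖((g : 𝔸ˣ) : 𝔸)‖ ≤ 1) (𝔢₀ : SectELettersY 𝔸 x) {U : CfgY 𝔸 x.toKIdx}
    (h𝔳 : ∀ b, 𝔳 U b ∈ G) {rμT rDT mμT mDT : ℝ} (hmμT : 0 ≤ mμT)
    (hμTr : ∀ (p : IBondY x.toKIdx) (s : SiteY x.toKIdx), blockCLM₂ (𝔢₀.muT U) p s ≠ 0 →
      tdistK (ℓ := ℓ) (Mh := x.Mh) (k := x.k) (P := x.P') (kLab x p) (πSY x s) ≤ rμT)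
    (hμTm : ∀ s : SiteY x.toKIdx, ∑ p, ‖blockCLM₂ (𝔢₀.muT U) p s‖ ≤ mμT)
    (hDTr : ∀ (s : SiteY x.toKIdx) (q : IBondY x.toKIdx), blockCLM₂ (𝔢₀.DbarT U) s q ≠ 0 →
      tdistK (ℓ := ℓ) (Mh := x.Mh) (k := x.k) (P := x.P') (πSY x s) (kLab x q) ≤ rDT)
    (hDTm : ∀ q : IBondY x.toKIdx, ∑ s, ‖blockCLM₂ (𝔢₀.DbarT U) s q‖ ≤ mDT) :
    LocalOuterY x (sectELettersYOfRecord x 𝔳 𝔢₀) (max 0 (max ((ℓ : ℝ) + 2) (rμT + rDT))) (1 + 4 * (((d + 1) * ℓ : ℕ) : ℝ)) (1 + mμT * mDT) U := by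
  have h := localOuterY_of_letters x (sectELettersYOfRecord x 𝔳 𝔢₀) U (πSY x) (rD := 1) (rμ := (ℓ : ℝ) + 1) (mD := 2)
    (mμ := 2 * (((d + 1) * ℓ : ℕ) : ℝ)) (by positivity) hmμT
    (fun p s hps => range₂_DbarY_le U hps) (rowMass₂_DbarY_le hG1 h𝔳)
    (fun s q hsq => range₂_muY_le U hsq) (rowMass₂_muY_le hG1 h𝔳) hμTr hμTm hDTr hDTm
  have e1 : (1 : ℝ) + ((ℓ : ℝ) + 1) = (ℓ : ℝ) + 2 := by ring
  have e2 : (1 : ℝ) + 2 * (2 * (((d + 1) * ℓ : ℕ) : ℝ)) = 1 + 4 * (((d + 1) * ℓ : ℕ) : ℝ) := by ring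
  rw [e1, e2] at h
  exact h

end Metric

end Literature.MathematicalPhysics.QuantumFieldTheory.Balaban1983to89.Node00
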